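import Mathlib
import Literature.NumberTheory.LFunctions.Zhang2022.SkeletonPartThree
import Literature.NumberTheory.LFunctions.Zhang2022.KappaLSeries
import Literature.NumberTheory.LFunctions.Zhang2022.SmoothWeightMellin
import Literature.NumberTheory.LFunctions.Zhang2022.PrimitiveCharOrthogonality
import HarnessLib

/-!
# Zhang (2022), typed statements of §15, block A: "Evaluation of `Φ₁`" from (15.1) to (15.11)
# (PDF pp. 79–83, displays (15.1)–(15.11) and the un-numbered steps `§15.u001–u025`)

Topic `Literature/NumberTheory/LFunctions/Zhang2022` (Landau–Siegel audit tree; verdict-neutral).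
Y. Zhang, *Discrete mean estimates and the Landau–Siegel zero*, arXiv:2211.02515v1 (2022)
[Zhang2022LandauSiegel] — **an unrefereed manuscript under adjudication. Nothing in this file
asserts or denies its Theorems 1–2; every `def … : Prop` below is a CLAIM OF THE MANUSCRIPT,
STATED NOT ASSERTED.** Campaign D-0069 (statement typing, layer L4), slice
`plan/L4/ASSIGNMENTS.md` v2 row L4-t1 = TeX lines 3980–4158 of the arXiv source = PDF pp. 79–83:
from (15.1) "`B(s,ψ) = Σ_n b(n)χψ(n)n^{−s}`" to the definition of `𝔇₁(d,l)` after (15.11).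
The objects it introduces (`𝔨₁`, `I₂^±`, `k̃`, `κ₁`, `g̃₃`, `κ₁*`, `a₁*`, `Φ₁(p)`, `κ̃₁`,
`λ₁`, `𝓡₁*`, `𝔇₁`) are real definitions over the banked skeleton's objects (`Skeleton*` files:
`Bpoly`, `bcoef`, `kstar1`, `Phi1`, `Theta2`, `main141`, `Kchar`, `gstar`, `DeltaW`, `deltaW`,
`nset`, `b1`, `b2`, `beta1…3`, …) and the tree's `MeanSquareMajorant.kappa₁` / `conv` / `tau`
(`KappaLSeries`, `Section14MeanSquareMajorant`); nothing banked is restated.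

| DAG node | locator | printed item | Lean |
|---|---|---|---|
| `Z22:(15.1)` | p.79, (15.1), tex L3980 | `B(s,ψ) = Σ_n b(n)χψ(n)n^{−s}` | CLAIM `Eq15_1` (`b` = `Skeleton.bcoef`, banked); the `ψ`-coefficient reading `Eq15_1R` (`bchi = χ·b`), bridge `eq15_1R_iff_eq15_1` |
| `Z22:(15.2)` | p.79, (15.2), tex L3983 | `b(n) ≪ τ₂(n)`, `b(n) = 0` if `n > PT⁻²η₊` | CLAIM `Eq15_2` |
| `Z22:§15.u001` | p.79, tex L3994 | `𝔨₁(s,ψ)` | object `frakk1` |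
| `Z22:§15.u002` | p.80, tex L3999 | `Σ_{ρ∈𝔷(ψ)} 𝔨₁*(ρ,ψ)ω(ρ) = I₂⁺(ψ) − I₂⁻(ψ) + O(ε)` | CLAIM `Step15_u002` |
| `Z22:§15.u003` | p.80, tex L4003 | `I₂^±(ψ) = (1/2πi)∫_{𝔍(±α)} 𝔨₁(s,ψ)ω(s)ds` | object `I2pm` (`I₂^± = I2pm … (±α)`) |
| `Z22:(15.3)` | p.80, (15.3), tex L4007 | `Φ₁ = Σ_{ψ∈Ψ₁}(I₂⁺(ψ) − I₂⁻(ψ)) + O(ε)` | CLAIM `Eq15_3` |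
| `Z22:(15.4)` | p.80, (15.4), tex L4012 | `Σ_{ψ∈Ψ₁} I₂⁻(ψ) = o(𝔓)` | CLAIM `Eq15_4` |
| `Z22:§15.u004` | p.80, tex L4017 | `L(s+β₁)L(s+β₂)/L(s) = (pt₀)^{−β₃}Z(s,ψ)·[ψ̄ at 1−s]·(1+O(𝓛⁻¹²³))` on `𝔍(−α)` | CLAIM `Step15_u004` |
| `Z22:§15.u005` | p.80, tex L4021 | `τ(χψ) = τ(χ)τ(ψ)ψ(D)χ(p)` | CLAIM `Step15_u005` |
| `Z22:§15.u006` | p.80, tex L4025 | `Z(s,ψ)/Z(s,χψ) = τ(χ)χ(p)ψ̄(D)D^{s−1}(1+O(e^{−πt}))` | CLAIM `Step15_u006` |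
| `Z22:§15.u007` | p.80, tex L4029 | `σ<0`: `L(1−s−β₁,ψ̄)L(1−s−β₂,ψ̄)K(1−s−β₃,ψ̄)/L(1−s,ψ̄) = Σ_m k̃(m)ψ̄(m)m^{s−1}`, `k̃ ≪ τ₄` | objects `ktilde`, `ktildeSeries`; CLAIM `Step15_u007` |
| `Z22:§15.u008` | p.80, tex L4033 | `Σ_{Ψ₁} I₂⁻(ψ) = τ(χ)Σ_{Ψ₁}χ(p_ψ)(p_ψt₀)^{−β₃}(1/2πi)∫_{𝔍(−1)}(…)B ω ds + o(𝔓)` | CLAIM `Step15_u008` |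
| `Z22:§15.u009` | p.80, tex L4037 | "the right side above is equal to `τ(χ)Σ_{p∼P}χ(p)(pt₀)^{−β₃}Σ*_{ψ mod p}(1/2πi)∫_{(−1/2)}(…)B ω ds + o(𝔓)`" | CLAIM `Step15_u009` |
| `Z22:§15.u010` | p.81, tex L4041 | `(1/2πi)∫_{(−1/2)} ω(s)ds/(n^s(Dm)^{1−s}) = (Dm)⁻¹(Dm/n)^{s₀}exp{−𝓛₂²log²(Dm/n)}` | CLAIM `Step15_u010` |
| `Z22:§15.u011` | p.81, tex L4045 | `Σ*_{ψ mod p} ψ(n)ψ̄(Dm) ≪ p` (`n = Dm`), `≪ 1` (`n ≠ Dm`) | object `sumPrim`; CLAIM `Step15_u011` |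
| `Z22:§15.u012` | p.81, tex L4052 | `Σ*_{ψ mod p}(1/2πi)∫_{(−1/2)}(…)B(s,ψ)ω(s)ds ≪ PD^{−4/5}` | CLAIM `Step15_u012` |
| `Z22:§15.u013` | p.81, tex L4065 | `ζ(s+β₁)ζ(s+β₂)/ζ(s) = Σ_m κ₁(m)m^{−s}`, `σ > 1` | object `kappa1` (= tree `MeanSquareMajorant.kappa₁ b₁ b₂`); CLAIM `Step15_u013` (tree: `MeanSquareMajorant.LSeries_kappa₁`) |
| `Z22:§15.u014` | p.81, tex L4069 | `L(s+β₁,ψ)L(s+β₂,ψ)B(s,ψ)/L(s,ψ) = Σ_m(κ₁∗b)(m)ψ(m)m^{−s}` | CLAIM `Step15_u014 c′ b` (node: `b = bLit`; see the χ-TWIST NOTE) |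
| `Z22:§15.u015` | p.81, tex L4073 | `K(1−s−β₃,ψ̄) = Σ_n g̃₃(n)ψ̄(n)n^{s−1}` | CLAIM `Step15_u015` |
| `Z22:§15.u016` | p.81, tex L4077 | `g̃₃(y) = y^{β₃}g*(P₄/y)` | object `gtilde3` |
| `Z22:(15.5)` | p.81, (15.5), tex L4081 | `Σ_{ψ∈Ψ₁} I₂⁺(ψ) = Θ₂(0,𝐤₁*,𝐚₁*) + O(ε)` | CLAIM `Eq15_5 c′ b` (node: `b = bLit`; χ-TWIST NOTE) |
| `Z22:§15.u017` | p.81, tex L4085 | `κ₁*(m) = (κ₁∗b)(m)`, `a₁*(n) = g̃₃(n)` | objects `kappaStar1`, `aStar1` |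
| `Z22:(15.6)` | p.81, (15.6), tex L4089 | `Φ₁ = Σ_{p∼P} Φ₁(p) + o(𝔓)` | CLAIM `Eq15_6 c′ b` |
| `Z22:(15.7)` | p.82, (15.7), tex L4094 | `Φ₁(p) = φ(D)⁻¹Σ_k μχ(k)/(kφ(k)) Σ_d g̃₃(dk)/d Σ_{(l,k)=1}(κ₁∗b)(dl)χ(l)Δ(l/(Dpk))` | object `Phi1pOf c′ χ b p` (general coefficients) / `Phi1p` (printed `b`) |
| `Z22:§15.u018` | p.82, tex L4099 | `(κ₁∗b)(dl) = Σ_{d=d₁d₂}Σ_{l=l₁l₂,(l₁,d₂)=1} b(d₂l₂)κ₁(d₁l₁)` | CLAIM `Step15_u018` |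
| `Z22:§15.u019` | p.82, tex L4103 | the re-arranged `l`-sum `Σ_{d=d₁d₂}Σ_{(l₂,k)=1}b(d₂l₂)χ(l₂)Σ_{(l₁,d₂k)=1}κ₁(d₁l₁)χ(l₁)Δ(l₁l₂/(Dpk))` | CLAIM `Step15_u019` |
| `Z22:(15.8)` | p.82, (15.8), tex L4109 | innermost sum `= (1/2πi)∫_{(2)}(Σ_{(l₁,d₂k)=1}κ₁(d₁l₁)χ(l₁)l₁^{−s})(Dpk/l₂)^sδ(s)ds` | CLAIM `Eq15_8` |
| `Z22:§15.u020` | p.82, tex L4114 | `Σ_{(l₁,d₂k)=1}κ₁(d₁l₁)χ(l₁)l₁^{−s} = κ̃₁(d₁;d₂k,s)Σ_{(l,d₁d₂k)=1}κ₁(l)χ(l)l^{−s} = κ̃₁λ₁·L(s+β₁,χ)L(s+β₂,χ)/L(s,χ)` | CLAIM `Step15_u020` |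
| `Z22:(15.9)` | p.82, (15.9), tex L4120 | `κ̃₁(d₁;r,s)` | object `kappaTilde1` |
| `Z22:(15.10)` | p.82, (15.10), tex L4124 | `λ₁(n,s)` | object `lam1` |
| `Z22:§15.u021` | p.82, tex L4129 | `Σ_{(l₁,d₂k)=1}κ₁(d₁l₁)χ(l₁)Δ(l₁l₂/(Dpk)) = 𝓡₁*(Dpk/l₂)κ̃₁(d₁;d₂k)λ₁(d₁d₂k) + O(α¹⁰⁰τ₃(d₁)Dpk/l₂)` | CLAIM `Step15_u021` |
| `Z22:§15.u022` | p.83, tex L4135 | `𝓡₁* = L(1+β₁,χ)L(1+β₂,χ)δ(1)/L′(1,χ)` | object `calR1star` |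
| `Z22:§15.u023` | p.83, tex L4139 | `Σ_{(l,k)=1}(κ₁∗b)(dl)χ(l)Δ(l/(Dpk)) = 𝓡₁*DpkΣ_{d=d₁d₂}κ̃₁(d₁;d₂k)λ₁(dk)Σ_{(l₂,k)=1}b(d₂l₂)χ(l₂)/l₂ + O(α⁵⁰τ₃(d₁)Dpk)` | CLAIM `Step15_u023 c′ b` |
| `Z22:§15.u024` | p.83, tex L4147 | the `d`-summed version with `O(α³⁰Dpk)` | CLAIM `Step15_u024 c′ b` |
| `Z22:(15.11)` | p.83, (15.11), tex L4154 | `Φ₁(p) = 𝓡₁*Dp/φ(D)·Σ_dΣ_l b(dl)χ(l)/(dl)·𝔇₁(d,l) + o(P)` | CLAIM `Eq15_11 c′ b` |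
| `Z22:§15.u025` | p.83, tex L4158 | `𝔇₁(d,l) = Σ_{(k,l)=1}μχ(k)/φ(k)Σ_m κ̃₁(m;dk)λ₁(mdk)g̃₃(mdk)/m` | object `calD1` |

PDF pages are read on the page images (`pages/p0079–p0083.txt`); `plan/DAG.tsv` v0's interpolated
pages for (15.6), u022–u025, (15.11) (82–85) are off by up to two. Object names follow the layer's
NAMING v1 (cell STATUS 2026-08-25T23:30Z): `kappa1`, `kappaTilde1`, `lam1`, `gtilde3`, `calD1`,
`calR1star`, `Phi1p`, `I2pm` — with the bodies the sibling slice `Typed.Section15B` declared as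
TODO-merge stubs, so that the merge is a rename-free import swap (`Phi1p c′ χ p` is the printed
instance of the coefficient-parametrised `Phi1pOf c′ χ b p`).

## The χ-twist note (typed AS PRINTED, flagged — not silently repaired)

(15.1) prints `B(s,ψ) = Σ_n b(n)χψ(n)n^{−s}`, so that `b` (the banked `Skeleton.bcoef`, the Dirichlet
convolution of the `ϰ`-weights of (12.2)) carries NO factor `χ`. From `§15.u014` on, however, the
manuscript uses `b` as the `ψ`-COEFFICIENT of `B(s,ψ)`: `§15.u014` "`L(s+β₁,ψ)L(s+β₂,ψ)B(s,ψ)/L(s,ψ)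
= Σ_m (κ₁∗b)(m)ψ(m)m^{−s}`" holds iff `b` there is `n ↦ χ(n)b(n)` (the tree's twisted product rule
`MeanSquareMajorant.LSeries_twist_conv_kappa₁`); likewise (15.5) (`Θ₂` of Prop. 14.1 carries
`Σ_m κ*(m)ψ(m)m^{−s}`), and the factor `χ(n₁)` on the right of Lemma 15.1 (with `b = χ·b₀`:
`Σ_{(n,𝔮)=1} b(n₁n)χ(n)ϱ*_j(n)/n = χ(n₁)Σ b₀(n₁n)ϱ*_j(n)/n`, `χ(n)² = 1` for `(n,D) = 1`, and the
`χ`-free sum is what Appendix B pp. 106–108 computes). This is the convention of (8.8) (`a₁₁ = χ·(ϰ₁ +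
ι₂ϰ₂)`, so that `A(𝐚₁₁;s,ψ) = H₁(s,ψ)`) and of §16 (`b₁` := the `ψ`-coefficients of `B(s,ψ)N(s+β₃,ψ)`).
The typed file therefore (i) states (15.1) literally (`Eq15_1`, `b = bcoef`) AND in the
`ψ`-coefficient form (`Eq15_1R`, `bchi χ n = χ(n)·bcoef D n`) — both are identities and they are
equivalent (`eq15_1R_iff_eq15_1`, kernel-checked, definitional); (ii) gives every `b`-dependent claim
of the slice (`Step15_u014`, `Eq15_5`, `Eq15_6`, `Step15_u018`, `Step15_u019`, `Step15_u023`,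
`Step15_u024`, `Eq15_11`) an explicit coefficient-family argument `b : CoefFam`, the DAG node being
the instance `b = bLit` (`(D,χ) ↦ bcoef D`, as printed) and the χ-absorbed reading the instance
`b = bChi` (`(D,χ) ↦ bchi χ`); the `b`-dependent objects `kappaStar1`, `Phi1pOf` take the sequence
`b : ℕ → ℂ`. Under `bLit` the displays `§15.u014` and (15.5) differ from the true identities by the
twist `χ(m)`; the purely algebraic steps `§15.u018/u019/u023/u024`, (15.11) do not depend on the
reading. Reported to L4-lead / sz-skel on STATUS (the banked `Skeleton.Lemma151` is typed with the
literal `bcoef`).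

Other print defects typed as printed and flagged in place: `§15.u023`'s error term `O(α⁵⁰τ₃(d₁)Dpk)`
has `d₁` bound inside `Σ_{d=d₁d₂}` (typed with `τ₃(d) ≥ τ₃(d₁)`); "`Assume dk < 2P₄`" (before
`§15.u018`) is carried as a hypothesis of `§15.u019/u021/u023` with `d = d₁d₂`; `α₁`-free here.

Conventions (skeleton `INTERFACE.md` §3): `Skeleton.ForAllLarge` = "for all sufficiently large `D`
and every real primitive `χ (mod D)`"; Assumption (A) = `Skeleton.AssumptionA D χ` as an antecedent
where the printed derivation uses it (Lemma 5.5, (5.15), Prop. 14.1, the `o(𝔓)` steps); "`X = Y +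
O(ε)`", `ε = exp{−c𝓛¹⁰}` (§4 p. 17, tex L1062) ↦ `∃ c > 0, ∃ C, … ‖X − Y‖ ≤ C·exp(−c𝓛¹⁰)`;
"`X = Y + o(𝔓)`" ↦ `∀ ε > 0, eventually ‖X − Y‖ ≤ ε𝔓`; "`X ≪ Y`" ↦ `∃ C, … ‖X‖ ≤ C·Y`;
"`X = M(1 + O(r))`" ↦ `‖X − M‖ ≤ C·r·‖M‖`; `ψ̄ = ψ⁻¹` (its `LFunction` is `L(·,ψ̄)`), `ψ̄(n) = conj ψ(n)`
as a coefficient; `τ_k` = the tree's `MeanSquareMajorant.tau k`; vertical-line integrals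
`(1/2πi)∫_{(σ)}F(s)ds` written inline in the tree's house style `(1/2π)∫_ℝ F(σ+it)dt` (cf.
`Lemma53.Delta1_56`), segments `𝔍(z)` = the tree's `Lemma81.segInt` / membership `MemJ`;
"`Σ*_{ψ (mod p)}`" (primitive characters) = `sumPrim`; unrestricted "`Σ_n`" of a finitely supported or
rapidly convergent summand = `∑'`; the `d, k, m`-sums against `g̃₃(dk)`, `g̃₃(mdk)` (zero for argument
`≥ 2P₄`) run over `1 ≤ · ≤ ⌊2P₄⌋` as in `Skeleton.main141`. The displays of this slice refine the
banked coarse deduction node `Skeleton.Ded1524 c′` (§15 ⇒ (15.24)).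

## References

* Y. Zhang, arXiv:2211.02515v1 (2022), §15 pp. 79–83, (15.1)–(15.11); §14 Prop. 14.1; §7 (7.17),
  (7.19); §8 (8.1); §5 Lemmas 5.1, 5.5, (5.15); §4 (ε, tex L1062).
  [cite: Zhang2022LandauSiegel, §15 pp. 79–83]
-/

noncomputable section

open Complex Real ComplexConjugate

namespace Literature.NumberTheory.LFunctions.Zhang2022.Typed.Section15A

open Literature.NumberTheory.LFunctions.Zhang2022.Skeleton

/-! ## Helpers: the segment `𝔍(z)`, primitive-character sums, coefficient families -/

/-- Membership `s ∈ 𝔍(z)`, the segment `[s₀ + z − i𝓛₁, s₀ + z + i𝓛₁]` (§7 p. 32, tex L1824;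
`s₀ = 1/2 + 2πit₀`): `Re s = 1/2 + z` and `|Im s − 2πt₀| ≤ 𝓛₁`. [cite: Zhang2022LandauSiegel, §7 p. 32] -/
def MemJ (D : ℕ) (z : ℝ) (s : ℂ) : Prop := s.re = 1 / 2 + z ∧ |s.im - 2 * π * t0 D| ≤ ell1 D

open scoped Classical in
/-- `Σ*_{ψ (mod p)} F(ψ)`: the sum over the PRIMITIVE characters `ψ (mod p)` (§15 p. 80, "`Σ*`" as in
§7 (7.3)); `F` may use the primitivity witness. [cite: Zhang2022LandauSiegel, §15 p. 80] -/
def sumPrim {p : ℕ} (F : (ψ : DirichletCharacter ℂ p) → ψ.IsPrimitive → ℂ) : ℂ :=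
  ∑ᶠ ψ : DirichletCharacter ℂ p, if h : ψ.IsPrimitive then F ψ h else 0

/-- A coefficient family `(D, χ) ↦ b` (the argument of the `b`-dependent claims; see the module's
χ-twist note): the printed instance is `bLit`, the χ-absorbed reading `bChi`.
[cite: Zhang2022LandauSiegel, §15 (15.1)] -/
abbrev CoefFam : Type := (D : ℕ) → DirichletCharacter ℂ D → ℕ → ℂ

/-- **`χ·b`**: `bchi χ n = χ(n)b(n)`, the `ψ`-coefficient of `B(s,ψ) = Σ_n b(n)χψ(n)n^{−s}` (15.1) —
the reading of "`b`" under which `§15.u014`, (15.5) and Lemma 15.1's factor `χ(n₁)` hold (module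
note). NOT a printed object; `b` itself is the banked `Skeleton.bcoef`. [cite: Zhang2022LandauSiegel, §15 (15.1)] -/
def bchi {D : ℕ} (χ : DirichletCharacter ℂ D) (n : ℕ) : ℂ := χ (n : ZMod D) * bcoef D n

/-- The printed coefficient family `(D, χ) ↦ b = Skeleton.bcoef D` of (15.1)/(12.2).
[cite: Zhang2022LandauSiegel, §15 (15.1)] -/
def bLit : CoefFam := fun D _ n => bcoef D n

/-- The χ-absorbed coefficient family `(D, χ) ↦ χ·b` (module note). [cite: Zhang2022LandauSiegel, §15 (15.1)] -/
def bChi : CoefFam := fun _ χ n => bchi χ n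

/-! ## (15.1)–(15.2): the coefficients `b(n)` of `B(s,ψ)` -/

/-- **(15.1)** (p. 79, tex L3980; DAG `Z22:(15.1)`): "In view of (12.2), `B(s,ψ)` can be written as
`B(s,ψ) = Σ_n b(n)χψ(n)n^{−s}`" — with `B = Skeleton.Bpoly` (12.2), `b = Skeleton.bcoef`,
`χψ(n) = Skeleton.pc`; the `n`-sum a series (finitely supported by (15.2)). CLAIM.
[cite: Zhang2022LandauSiegel, §15 (15.1) p. 79] -/
def Eq15_1 : Prop :=
  ∀ (D : ℕ) [NeZero D] (χ : DirichletCharacter ℂ D) (x : Chr D) (s : ℂ),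
    Bpoly χ x s = ∑' n : ℕ, bcoef D n * pc χ x n * (n : ℂ) ^ (-s)

/-- **(15.1), `ψ`-coefficient form** (module χ-twist note): `B(s,ψ) = Σ_n (χb)(n)ψ(n)n^{−s}`.
Equivalent to `Eq15_1` (`eq15_1R_iff_eq15_1`). CLAIM. [cite: Zhang2022LandauSiegel, §15 (15.1) p. 79] -/
def Eq15_1R : Prop :=
  ∀ (D : ℕ) [NeZero D] (χ : DirichletCharacter ℂ D) (x : Chr D) (s : ℂ),
    Bpoly χ x s = ∑' n : ℕ, bchi χ n * x.ψ (n : ZMod x.p) * (n : ℂ) ^ (-s)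

/-- The two forms of (15.1) are the same statement (`b(n)χψ(n) = (χ(n)b(n))ψ(n)`, definitional).
[cite: Zhang2022LandauSiegel, §15 (15.1) p. 79] -/
theorem eq15_1R_iff_eq15_1 : Eq15_1R ↔ Eq15_1 := by
  have key : ∀ (D : ℕ) [NeZero D] (χ : DirichletCharacter ℂ D) (x : Chr D) (s : ℂ),
      (∑' n : ℕ, bchi χ n * x.ψ (n : ZMod x.p) * (n : ℂ) ^ (-s)) =
        ∑' n : ℕ, bcoef D n * pc χ x n * (n : ℂ) ^ (-s) := by
    intro D _ χ x s
    refine tsum_congr fun n => ?_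
    rw [bchi, pc]
    ring
  constructor
  · intro h D _ χ x s
    rw [← key]
    exact h D χ x s
  · intro h D _ χ x s
    rw [key]
    exact h D χ x s

/-- **(15.2)** (p. 79, tex L3983; DAG `Z22:(15.2)`): "`b(n) ≪ τ₂(n)`, `b(n) = 0` if `n > PT⁻²η₊`"
(`τ₂` = the number of divisors, the tree's `MeanSquareMajorant.tau 2`; `η₊ = exp{𝓛⁻¹⁰}` =
`Skeleton.etaPM D 1`; `PT⁻²` = `bigP D / bigT D ^ 2`). CLAIM. [cite: Zhang2022LandauSiegel, §15 (15.2) p. 79] -/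
def Eq15_2 : Prop :=
  ∃ C : ℝ, ForAllLarge fun D _ _ =>
    (∀ n : ℕ, ‖bcoef D n‖ ≤ C * MeanSquareMajorant.tau 2 n) ∧
    ∀ n : ℕ, bigP D / bigT D ^ 2 * etaPM D 1 < n → bcoef D n = 0

/-! ## `𝔨₁(s,ψ)`, `I₂^±(ψ)`, (15.3), (15.4) -/

section KOne

variable (c' : ℝ) {D : ℕ} [NeZero D] (χ : DirichletCharacter ℂ D) (x : Chr D)

/-- **`𝔨₁(s,ψ) = Z(s,χψ)⁻¹ · L(s+β₁,ψ)L(s+β₂,ψ)/L(s,ψ) · B(s,ψ)K(1−s−β₃,ψ̄)`** (p. 79, tex L3994; DAG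
`Z22:§15.u001`, step-def) — the `𝔨₁*` of (13.4) (`Skeleton.kstar1`) with `L(s,ψ)` in place of
`L′(ρ,ψ)`. [cite: Zhang2022LandauSiegel, §15 p. 79] -/
def frakk1 (s : ℂ) : ℂ :=
  (Zpc χ x s)⁻¹ *
    (x.ψ.LFunction (s + beta1 c' D) * x.ψ.LFunction (s + beta2 c' D) / x.ψ.LFunction s) *
    Bpoly χ x s * Kchar D (psiBarFn x) (1 - s - beta3 c' D)

/-- **`I₂^±(ψ) = (1/2πi)∫_{𝔍(±α)} 𝔨₁(s,ψ)ω(s) ds`** (p. 80, tex L4003; DAG `Z22:§15.u003`, step-def),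
as a function of the abscissa `z` of the segment `𝔍(z)` (the tree's `Lemma81.segInt`):
`I₂⁺(ψ) = I2pm c′ χ x α`, `I₂⁻(ψ) = I2pm c′ χ x (−α)`. [cite: Zhang2022LandauSiegel, §15 p. 80] -/
def I2pm (z : ℝ) : ℂ :=
  Lemma81.segInt (t0 D) (ell1 D) (z : ℂ) fun s => frakk1 c' χ x s * omegaW D s

end KOne

/-- **§15 p. 80, tex L3999 (DAG `Z22:§15.u002`)**: "Similar to (8.1), for `ψ ∈ Ψ₁` we have
`Σ_{ρ∈𝔷(ψ)} 𝔨₁*(ρ,ψ)ω(ρ) = I₂⁺(ψ) − I₂⁻(ψ) + O(ε)`" (`𝔨₁*` = `Skeleton.kstar1` (13.4),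
`ε = exp{−c𝓛¹⁰}`). CLAIM. [cite: Zhang2022LandauSiegel, §15 p. 80] -/
def Step15_u002 (c' : ℝ) : Prop :=
  ∃ c : ℝ, 0 < c ∧ ∃ C : ℝ, ForAllLarge fun D _ χ => AssumptionA D χ → ∀ x ∈ PsiOne χ,
    ‖(∑ ρ ∈ finsetOf (zeroSet D x), kstar1 c' χ x ρ * omegaW D ρ) -
        (I2pm c' χ x (alpha D) - I2pm c' χ x (-alpha D))‖ ≤ C * Real.exp (-c * ell D ^ 10)

/-- **(15.3)** (p. 80, tex L4007; DAG `Z22:(15.3)`): "Hence `Φ₁ = Σ_{ψ∈Ψ₁}(I₂⁺(ψ) − I₂⁻(ψ)) + O(ε)`"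
(`Φ₁` = `Skeleton.Phi1` (13.8)). CLAIM. [cite: Zhang2022LandauSiegel, §15 (15.3) p. 80] -/
def Eq15_3 (c' : ℝ) : Prop :=
  ∃ c : ℝ, 0 < c ∧ ∃ C : ℝ, ForAllLarge fun D _ χ => AssumptionA D χ →
    ‖Phi1 c' χ - ∑ x ∈ finsetOf (PsiOne χ), (I2pm c' χ x (alpha D) - I2pm c' χ x (-alpha D))‖
      ≤ C * Real.exp (-c * ell D ^ 10)

/-- **(15.4)** (p. 80, tex L4012; DAG `Z22:(15.4)`): "First we prove that `Σ_{ψ∈Ψ₁} I₂⁻(ψ) = o(𝔓)`."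
CLAIM (proved on pp. 80–81 via `§15.u004–u012`). [cite: Zhang2022LandauSiegel, §15 (15.4) p. 80] -/
def Eq15_4 (c' : ℝ) : Prop :=
  ∀ ε : ℝ, 0 < ε → ForAllLarge fun D _ χ => AssumptionA D χ →
    ‖∑ x ∈ finsetOf (PsiOne χ), I2pm c' χ x (-alpha D)‖ ≤ ε * frakP D

/-! ## The proof of (15.4): `§15.u004–u012` -/

/-- **§15 p. 80, tex L4017 (DAG `Z22:§15.u004`)**: "Assume `ψ ∈ Ψ₁` and `s ∈ 𝔍(−α)`. By (2.2) and
Lemma 5.1, `L(s+β₁,ψ)L(s+β₂,ψ)/L(s,ψ) = (pt₀)^{−β₃}Z(s,ψ)·L(1−s−β₁,ψ̄)L(1−s−β₂,ψ̄)/L(1−s,ψ̄)·(1 +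
O(𝓛⁻¹²³))`" (typed as `‖LHS − M‖ ≤ C𝓛⁻¹²³‖M‖`, `M` the printed main term; `ψ̄ = ψ⁻¹`). CLAIM.
[cite: Zhang2022LandauSiegel, §15 p. 80] -/
def Step15_u004 (c' : ℝ) : Prop :=
  ∃ C : ℝ, ForAllLarge fun D _ χ => ∀ x ∈ PsiOne χ, ∀ s : ℂ, MemJ D (-alpha D) s →
    let M : ℂ := (((x.p : ℝ) * t0 D : ℝ) : ℂ) ^ (-beta3 c' D) * GammaFactor.Zfac x.ψ s *
      (x.ψ⁻¹.LFunction (1 - s - beta1 c' D) * x.ψ⁻¹.LFunction (1 - s - beta2 c' D) /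
        x.ψ⁻¹.LFunction (1 - s))
    ‖x.ψ.LFunction (s + beta1 c' D) * x.ψ.LFunction (s + beta2 c' D) / x.ψ.LFunction s - M‖
      ≤ C * (ell D ^ 123)⁻¹ * ‖M‖

/-- **§15 p. 80, tex L4021 (DAG `Z22:§15.u005`)**: "the relation `τ(χψ) = τ(χ)τ(ψ)ψ(D)χ(p)`" (Gauss
sums to coprime moduli; `χψ` = `Skeleton.psiChi` mod `Dp`, `τ` = the tree's `GammaFactor.tau`; the
coprimality `(D, p) = 1`, automatic for `p ∼ P > D`, is carried as a hypothesis). CLAIM.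
[cite: Zhang2022LandauSiegel, §15 p. 80] -/
def Step15_u005 : Prop :=
  ∀ (D : ℕ) [NeZero D] (χ : DirichletCharacter ℂ D) (x : Chr D), Nat.Coprime D x.p →
    GammaFactor.tau (psiChi χ x) =
      GammaFactor.tau χ * GammaFactor.tau x.ψ * x.ψ (D : ZMod x.p) * χ (x.p : ZMod D)

/-- **§15 p. 80, tex L4025 (DAG `Z22:§15.u006`)**: "by (2.4), (2.5) and the relation [u005], we have
`Z(s,ψ)/Z(s,χψ) = τ(χ)χ(p)ψ̄(D)D^{s−1}(1 + O(e^{−πt}))`" (for `ψ ∈ Ψ₁`, `s ∈ 𝔍(−α)` as assumed before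
u004; `t = Im s`; typed as `‖LHS − M‖ ≤ Ce^{−πt}‖M‖`). CLAIM. [cite: Zhang2022LandauSiegel, §15 p. 80] -/
def Step15_u006 : Prop :=
  ∃ C : ℝ, ForAllLarge fun D _ χ => ∀ x ∈ PsiOne χ, ∀ s : ℂ, MemJ D (-alpha D) s →
    let M : ℂ := GammaFactor.tau χ * χ (x.p : ZMod D) * conj (x.ψ (D : ZMod x.p)) *
      (D : ℂ) ^ (s - 1)
    ‖GammaFactor.Zfac x.ψ s / Zpc χ x s - M‖ ≤ C * Real.exp (-π * s.im) * ‖M‖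

section KTilde

variable (c' : ℝ)

/-- **`g̃₃(y) = y^{β₃}g*(P₄/y)`** (p. 81, tex L4077; DAG `Z22:§15.u016`, step-def; `g*` =
`Skeleton.gstar`, `P₄` = `Skeleton.P4`). Defined here, ahead of its printed position, because the
coefficients `k̃` of u007 are `κ₁(−β)∗g̃₃`. [cite: Zhang2022LandauSiegel, §15 p. 81] -/
def gtilde3 (D : ℕ) (y : ℝ) : ℂ := (y : ℂ) ^ beta3 c' D * (gstar D (P4 D / y) : ℂ)

/-- **`k̃(m)`** (p. 80, tex L4029; DAG `Z22:§15.u007`): the manuscript introduces `k̃` implicitly as the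
`ψ̄`-coefficients of `L(1−s−β₁,ψ̄)L(1−s−β₂,ψ̄)K(1−s−β₃,ψ̄)/L(1−s,ψ̄)` ("we can write … = Σ_m
k̃(m)ψ̄(m)m^{s−1} with `k̃(m) ≪ τ₄(m)`"); as a Dirichlet series in `w = 1 − s` this is
`[ζ(w−β₁)ζ(w−β₂)/ζ(w)]`-coefficients (the tree's `MeanSquareMajorant.kappa₁ (−b₁) (−b₂)`, `β_j = ib_j`)
convolved with `n ↦ n^{β₃}g*(P₄/n) = g̃₃(n)` (u015/u016). [cite: Zhang2022LandauSiegel, §15 p. 80] -/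
def ktilde (D : ℕ) : ℕ → ℂ :=
  MeanSquareMajorant.conv (MeanSquareMajorant.kappa₁ (-b1 c' D) (-b2 c' D)) fun n => gtilde3 c' D n

variable {D : ℕ} (x : Chr D)

/-- The series `Σ_m k̃(m)ψ̄(Dm)(Dm)^{s−1}` of u008/u009/u012 (p. 80). [cite: Zhang2022LandauSiegel, §15 p. 80] -/
def ktildeSeries (s : ℂ) : ℂ :=
  ∑' m : ℕ, ktilde c' D m * conj (x.ψ ((D * m : ℕ) : ZMod x.p)) / ((D * m : ℕ) : ℂ) ^ (1 - s)

end KTilde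

/-- **§15 p. 80, tex L4029 (DAG `Z22:§15.u007`)**: "For `σ < 0` we can write
`L(1−s−β₁,ψ̄)L(1−s−β₂,ψ̄)K(1−s−β₃,ψ̄)/L(1−s,ψ̄) = Σ_m k̃(m)ψ̄(m)m^{s−1}` with `k̃(m) ≪ τ₄(m)`" (`ψ̄(m) =
conj ψ(m)`, `L(·,ψ̄) = ψ⁻¹.LFunction`, `K` = `Skeleton.Kchar … (psiBarFn x)`; `k̃` = `ktilde`). CLAIM.
[cite: Zhang2022LandauSiegel, §15 p. 80] -/
def Step15_u007 (c' : ℝ) : Prop :=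
  ∃ C : ℝ, ForAllLarge fun D _ _ =>
    (∀ m : ℕ, ‖ktilde c' D m‖ ≤ C * MeanSquareMajorant.tau 4 m) ∧
    ∀ x : Chr D, ∀ s : ℂ, s.re < 0 →
      x.ψ⁻¹.LFunction (1 - s - beta1 c' D) * x.ψ⁻¹.LFunction (1 - s - beta2 c' D) *
          Kchar D (psiBarFn x) (1 - s - beta3 c' D) / x.ψ⁻¹.LFunction (1 - s) =
        ∑' m : ℕ, ktilde c' D m * conj (x.ψ (m : ZMod x.p)) / (m : ℂ) ^ (1 - s)

/-- **§15 p. 80, tex L4033 (DAG `Z22:§15.u008`)**: "Hence, moving the segment `𝔍(−α)` to `𝔍(−1)` with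
a negligible error, we find that `Σ_{ψ∈Ψ₁} I₂⁻(ψ) = τ(χ)Σ_{ψ∈Ψ₁} χ(p_ψ)(p_ψt₀)^{−β₃}·(1/2πi)∫_{𝔍(−1)}
(Σ_m k̃(m)ψ̄(Dm)(Dm)^{s−1})B(s,ψ)ω(s)ds + o(𝔓)`." CLAIM. [cite: Zhang2022LandauSiegel, §15 p. 80] -/
def Step15_u008 (c' : ℝ) : Prop :=
  ∀ ε : ℝ, 0 < ε → ForAllLarge fun D _ χ => AssumptionA D χ →
    ‖(∑ x ∈ finsetOf (PsiOne χ), I2pm c' χ x (-alpha D)) -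
        GammaFactor.tau χ * ∑ x ∈ finsetOf (PsiOne χ),
          χ (x.p : ZMod D) * (((x.p : ℝ) * t0 D : ℝ) : ℂ) ^ (-beta3 c' D) *
            Lemma81.segInt (t0 D) (ell1 D) (-1) (fun s =>
              ktildeSeries c' x s * Bpoly χ x s * omegaW D s)‖ ≤ ε * frakP D

/-- **§15 p. 80, tex L4037 (DAG `Z22:§15.u009`)**: "In a way similar to the proof of (7.3), the sum over
`ψ ∈ Ψ₁` can be extended to the sum over `ψ ∈ Ψ`, and then the segment `𝔍(−1)` can be replaced by
the line `σ = −1/2`, with acceptable errors. Thus the right side above is equal to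
`τ(χ)Σ_{p∼P} χ(p)(pt₀)^{−β₃} Σ*_{ψ (mod p)} (1/2πi)∫_{(−1/2)}(Σ_m k̃(m)ψ̄(Dm)(Dm)^{s−1})B(s,ψ)ω(s)ds
+ o(𝔓)`" (the double sum `Σ_{p∼P}Σ*_{ψ mod p}` = the sum over all `x : Skeleton.Chr D`). CLAIM.
[cite: Zhang2022LandauSiegel, §15 p. 80] -/
def Step15_u009 (c' : ℝ) : Prop :=
  ∀ ε : ℝ, 0 < ε → ForAllLarge fun D _ χ => AssumptionA D χ →
    ‖GammaFactor.tau χ * (∑ x ∈ finsetOf (PsiOne χ),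
          χ (x.p : ZMod D) * (((x.p : ℝ) * t0 D : ℝ) : ℂ) ^ (-beta3 c' D) *
            Lemma81.segInt (t0 D) (ell1 D) (-1) (fun s =>
              ktildeSeries c' x s * Bpoly χ x s * omegaW D s)) -
        GammaFactor.tau χ * ∑ᶠ x : Chr D,
          χ (x.p : ZMod D) * (((x.p : ℝ) * t0 D : ℝ) : ℂ) ^ (-beta3 c' D) *
            ((1 / (2 * π) : ℂ) * ∫ t : ℝ, ktildeSeries c' x (-1 / 2 + t * I) *
              Bpoly χ x (-1 / 2 + t * I) * omegaW D (-1 / 2 + t * I))‖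
      ≤ ε * frakP D

/-- **§15 p. 81, tex L4041 (DAG `Z22:§15.u010`)**: "Since
`(1/2πi)∫_{(−1/2)} ω(s)ds/(n^s(Dm)^{1−s}) = (Dm)⁻¹(Dm/n)^{s₀}exp{−𝓛₂²log²(Dm/n)}`" (a Gaussian
integral; `n, m ≥ 1`, `𝓛₂ = (log D)⁴⁰⁰ > 0`, i.e. `D ≥ 2`). CLAIM. [cite: Zhang2022LandauSiegel, §15 p. 81] -/
def Step15_u010 : Prop :=
  ∀ (D n m : ℕ), 2 ≤ D → 0 < n → 0 < m →
    (1 / (2 * π) : ℂ) * (∫ t : ℝ, omegaW D (-1 / 2 + t * I) /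
        ((n : ℂ) ^ (-1 / 2 + t * I : ℂ) * ((D * m : ℕ) : ℂ) ^ (1 - (-1 / 2 + t * I : ℂ)))) =
      ((D * m : ℕ) : ℂ)⁻¹ * ((((D * m : ℕ) : ℝ) / n : ℝ) : ℂ) ^ s0 D *
        (Real.exp (-(ell2 D ^ 2 * Real.log (((D * m : ℕ) : ℝ) / n) ^ 2)) : ℂ)

/-- **§15 p. 81, tex L4045 (DAG `Z22:§15.u011`)**: "for `n < PT⁻⁵` and `Dm < 2n`,
`Σ*_{ψ (mod p)} ψ(n)ψ̄(Dm) ≪ p` if `n = Dm`, `≪ 1` if `n ≠ Dm`" (`p ∼ P`). CLAIM.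
[cite: Zhang2022LandauSiegel, §15 p. 81] -/
def Step15_u011 : Prop :=
  ∃ C : ℝ, ForAllLarge fun D _ _ => ∀ p ∈ primeWindow D, ∀ n m : ℕ,
    (n : ℝ) < bigP D / bigT D ^ 5 → (((D * m : ℕ) : ℝ)) < 2 * n →
      ‖sumPrim fun (ψ : DirichletCharacter ℂ p) _ =>
          ψ (n : ZMod p) * conj (ψ ((D * m : ℕ) : ZMod p))‖ ≤ if n = D * m then C * p else C

/-- **§15 p. 81, tex L4052 (DAG `Z22:§15.u012`)**: "it follows that
`Σ*_{ψ (mod p)} (1/2πi)∫_{(−1/2)}(Σ_m k̃(m)ψ̄(Dm)(Dm)^{s−1})B(s,ψ)ω(s)ds ≪ PD^{−4/5}`" (`p ∼ P`; this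
yields (15.4)). CLAIM. [cite: Zhang2022LandauSiegel, §15 p. 81] -/
def Step15_u012 (c' : ℝ) : Prop :=
  ∃ C : ℝ, ForAllLarge fun D _ χ => ∀ (p : ℕ) (hp : p ∈ primeWindow D),
    ‖sumPrim fun (ψ : DirichletCharacter ℂ p) hψ =>
        (1 / (2 * π) : ℂ) * ∫ t : ℝ,
          ktildeSeries c' (⟨p, hp, ψ, hψ⟩ : Chr D) (-1 / 2 + t * I) *
            Bpoly χ ⟨p, hp, ψ, hψ⟩ (-1 / 2 + t * I) * omegaW D (-1 / 2 + t * I)‖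
      ≤ C * bigP D * (D : ℝ) ^ (-(4 / 5 : ℝ))

/-! ## `κ₁`, `g̃₃`, `κ₁*`, `a₁*` and (15.5)–(15.7) -/

section KappaOne

variable (c' : ℝ)

/-- **`κ₁`** (p. 81, tex L4065; DAG `Z22:§15.u013`, step-def): "Let `κ₁(m)` be given by
`ζ(s+β₁)ζ(s+β₂)/ζ(s) = Σ_m κ₁(m)m^{−s}`, `σ > 1`" — the tree's `MeanSquareMajorant.kappa₁ b₁ b₂`
(`β_j = ib_j`, `b_j = Skeleton.b1/b2`), the Dirichlet convolution `n^{−β₁} ∗ n^{−β₂} ∗ μ`, whose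
generating function is that quotient (`MeanSquareMajorant.LSeries_kappa₁`).
[cite: Zhang2022LandauSiegel, §15 p. 81] -/
def kappa1 (D : ℕ) : ArithmeticFunction ℂ := MeanSquareMajorant.kappa₁ (b1 c' D) (b2 c' D)

/-- **`κ₁*(m) = (κ₁ ∗ b)(m)`** (p. 81, tex L4085; DAG `Z22:§15.u017`, step-def), for a coefficient
sequence `b` (printed: `b = Skeleton.bcoef D`; χ-absorbed reading `bchi χ`, module note); `∗` = the
tree's `MeanSquareMajorant.conv`. [cite: Zhang2022LandauSiegel, §15 p. 81] -/
def kappaStar1 (D : ℕ) (b : ℕ → ℂ) : ℕ → ℂ := MeanSquareMajorant.conv (kappa1 c' D) b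

/-- **`a₁*(n) = g̃₃(n)`** (p. 81, tex L4085; DAG `Z22:§15.u017`, step-def).
[cite: Zhang2022LandauSiegel, §15 p. 81] -/
def aStar1 (D : ℕ) : ℕ → ℂ := fun n => gtilde3 c' D n

variable {D : ℕ} [NeZero D] (χ : DirichletCharacter ℂ D)

/-- **`Φ₁(p)`** (p. 82, (15.7), tex L4094; DAG `Z22:(15.7)`, definition):
`Φ₁(p) = φ(D)⁻¹ Σ_k μχ(k)/(kφ(k)) Σ_d g̃₃(dk)/d Σ_{(l,k)=1} (κ₁∗b)(dl)χ(l)Δ(l/(Dpk))`, for a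
coefficient sequence `b` (printed `b = Skeleton.bcoef D`); `Δ` = `Skeleton.DeltaW` (5.7); the `l`-sum a
series, `d, k ≤ 2P₄` (`g̃₃(dk) = 0` beyond) as in `Skeleton.main141` — of which this is the `p`-summand
at `β = 0`, `κ* = κ₁*`, `a* = a₁*`. [cite: Zhang2022LandauSiegel, §15 (15.7) p. 82] -/
def Phi1pOf (b : ℕ → ℂ) (p : ℕ) : ℂ :=
  (Nat.totient D : ℂ)⁻¹ *
    ∑ k ∈ Finset.Icc 1 ⌊2 * P4 D⌋₊,
      (ArithmeticFunction.moebius k : ℂ) * χ (k : ZMod D) / ((k : ℂ) * Nat.totient k) *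
        ∑ d ∈ Finset.Icc 1 ⌊2 * P4 D⌋₊, gtilde3 c' D ((d * k : ℕ) : ℝ) / (d : ℂ) *
          ∑' l : ℕ, if Nat.Coprime l k then
            kappaStar1 c' D b (d * l) * χ (l : ZMod D) * DeltaW D ((l : ℝ) / ((D : ℝ) * p * k))
          else 0

/-- **`Φ₁(p)` as printed** ((15.7), p. 82, tex L4094; DAG `Z22:(15.7)`): `Phi1pOf` at the printed
coefficients `b = Skeleton.bcoef D` (L4 NAMING v1 `Phi1p c′ χ p`; the χ-absorbed reading is
`Phi1pOf c′ χ (bchi χ) p`). [cite: Zhang2022LandauSiegel, §15 (15.7) p. 82] -/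
def Phi1p (p : ℕ) : ℂ := Phi1pOf c' χ (bcoef D) p

end KappaOne

/-- **§15 p. 81, tex L4065 (DAG `Z22:§15.u013`)**, the defining display of `κ₁` as a claim about the
object: for `σ > 1`, `ζ(s+β₁)ζ(s+β₂)/ζ(s) = Σ_m κ₁(m)m^{−s}`. CLAIM — a theorem of the tree up to the
rewriting `β_j = ib_j` (`MeanSquareMajorant.LSeries_kappa₁`). [cite: Zhang2022LandauSiegel, §15 p. 81] -/
def Step15_u013 (c' : ℝ) : Prop :=
  ∀ (D : ℕ) (s : ℂ), 1 < s.re →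
    riemannZeta (s + beta1 c' D) * riemannZeta (s + beta2 c' D) / riemannZeta s =
      ∑' m : ℕ, kappa1 c' D m / (m : ℂ) ^ s

/-- **§15 p. 81, tex L4069 (DAG `Z22:§15.u014`)**: "Regarding `b` as an arithmetic function, for `σ > 1`
we have `L(s+β₁,ψ)L(s+β₂,ψ)B(s,ψ)/L(s,ψ) = Σ_m (κ₁∗b)(m)ψ(m)m^{−s}`", for a coefficient family `b`:
the printed node is `b = bLit` (`Skeleton.bcoef`) — AS PRINTED, and then the two sides differ by the
twist `χ(m)` (module χ-twist note; with `b = bChi` it is the tree's product rule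
`MeanSquareMajorant.LSeries_twist_conv_kappa₁`). CLAIM. [cite: Zhang2022LandauSiegel, §15 p. 81] -/
def Step15_u014 (c' : ℝ) (b : CoefFam) : Prop :=
  ∀ (D : ℕ) [NeZero D] (χ : DirichletCharacter ℂ D) (x : Chr D) (s : ℂ), 1 < s.re →
    x.ψ.LFunction (s + beta1 c' D) * x.ψ.LFunction (s + beta2 c' D) * Bpoly χ x s /
        x.ψ.LFunction s =
      ∑' m : ℕ, kappaStar1 c' D (b D χ) m * x.ψ (m : ZMod x.p) / (m : ℂ) ^ s

/-- **§15 p. 81, tex L4073 (DAG `Z22:§15.u015`)**: "On the other hand, we can write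
`K(1−s−β₃,ψ̄) = Σ_n g̃₃(n)ψ̄(n)n^{s−1}`" (`K` = `Skeleton.Kchar D (psiBarFn x)`, a finite sum; `g̃₃` =
`gtilde3`, zero for `n ≥ 2P₄`). CLAIM. [cite: Zhang2022LandauSiegel, §15 p. 81] -/
def Step15_u015 (c' : ℝ) : Prop :=
  ∀ (D : ℕ) (x : Chr D) (s : ℂ),
    Kchar D (psiBarFn x) (1 - s - beta3 c' D) =
      ∑' n : ℕ, gtilde3 c' D n * conj (x.ψ (n : ZMod x.p)) / (n : ℂ) ^ (1 - s)

/-- **(15.5)** (p. 81, tex L4081; DAG `Z22:(15.5)`): "Hence, moving the segment `𝔍(α)` to `𝔍(1)` with a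
negligible error, we obtain `Σ_{ψ∈Ψ₁} I₂⁺(ψ) = Θ₂(0,𝐤₁*,𝐚₁*) + O(ε)` with `κ₁*(m) = (κ₁∗b)(m)`,
`a₁*(n) = g̃₃(n)`" (`Θ₂` = `Skeleton.Theta2` of Prop. 14.1 at `β = 0`), for a coefficient family `b`:
printed node `b = bLit`; it is the χ-absorbed instance `b = bChi` that matches `𝔨₁` (module note).
CLAIM. [cite: Zhang2022LandauSiegel, §15 (15.5) p. 81] -/
def Eq15_5 (c' : ℝ) (b : CoefFam) : Prop :=
  ∃ c : ℝ, 0 < c ∧ ∃ C : ℝ, ForAllLarge fun D _ χ => AssumptionA D χ →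
    ‖(∑ x ∈ finsetOf (PsiOne χ), I2pm c' χ x (alpha D)) -
        Theta2 χ 0 (kappaStar1 c' D (b D χ)) (aStar1 c' D)‖ ≤ C * Real.exp (-c * ell D ^ 10)

/-- **(15.6)** (p. 81, tex L4089; DAG `Z22:(15.6)`): "It follows by (15.3)–(15.5) and Proposition 14.1
that `Φ₁ = Σ_{p∼P} Φ₁(p) + o(𝔓)`" with `Φ₁(p)` as in (15.7) (`Phi1pOf … b`), for a coefficient family
`b` (printed node `b = bLit`). CLAIM. [cite: Zhang2022LandauSiegel, §15 (15.6) p. 81] -/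
def Eq15_6 (c' : ℝ) (b : CoefFam) : Prop :=
  ∀ ε : ℝ, 0 < ε → ForAllLarge fun D _ χ => AssumptionA D χ →
    ‖Phi1 c' χ - ∑ p ∈ primeWindow D, Phi1pOf c' χ (b D χ) p‖ ≤ ε * frakP D

/-! ## From (15.7) to (15.11): `§15.u018–u025`, (15.8)–(15.10) -/

/-- **§15 p. 82, tex L4099 (DAG `Z22:§15.u018`)**: "Assume `dk < 2P₄`. Similar to (7.17),
`(κ₁∗b)(dl) = Σ_{d=d₁d₂} Σ_{l=l₁l₂,(l₁,d₂)=1} b(d₂l₂)κ₁(d₁l₁)`" (a regrouping of the Dirichlet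
convolution valid for all `d, l ≥ 1`; `k` does not enter), for a coefficient family `b` (printed
`b = bLit`). CLAIM. [cite: Zhang2022LandauSiegel, §15 p. 82] -/
def Step15_u018 (c' : ℝ) (b : CoefFam) : Prop :=
  ∀ (D : ℕ) [NeZero D] (χ : DirichletCharacter ℂ D) (d l : ℕ), 0 < d → 0 < l →
    kappaStar1 c' D (b D χ) (d * l) =
      ∑ dd ∈ d.divisorsAntidiagonal,
        ∑ ll ∈ (l.divisorsAntidiagonal).filter (fun ll => Nat.Coprime ll.1 dd.2),
          b D χ (dd.2 * ll.2) * kappa1 c' D (dd.1 * ll.1)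

/-- **§15 p. 82, tex L4103 (DAG `Z22:§15.u019`)**: "This yields `Σ_{(l,k)=1} (κ₁∗b)(dl)χ(l)Δ(l/(Dpk))
= Σ_{d=d₁d₂} Σ_{(l₂,k)=1} b(d₂l₂)χ(l₂) Σ_{(l₁,d₂k)=1} κ₁(d₁l₁)χ(l₁)Δ(l₁l₂/(Dpk))`" (for `p ∼ P`,
`dk < 2P₄`), for a coefficient family `b` (printed `b = bLit`). CLAIM. [cite: Zhang2022LandauSiegel, §15 p. 82] -/
def Step15_u019 (c' : ℝ) (b : CoefFam) : Prop :=
  ∀ (D : ℕ) [NeZero D] (χ : DirichletCharacter ℂ D) (p d k : ℕ), p ∈ primeWindow D → 0 < d → 0 < k →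
    ((d * k : ℕ) : ℝ) < 2 * P4 D →
      (∑' l : ℕ, if Nat.Coprime l k then
          kappaStar1 c' D (b D χ) (d * l) * χ (l : ZMod D) * DeltaW D ((l : ℝ) / ((D : ℝ) * p * k))
        else 0) =
      ∑ dd ∈ d.divisorsAntidiagonal,
        ∑' l₂ : ℕ, if Nat.Coprime l₂ k then
          b D χ (dd.2 * l₂) * χ (l₂ : ZMod D) *
            ∑' l₁ : ℕ, (if Nat.Coprime l₁ (dd.2 * k) then
              kappa1 c' D (dd.1 * l₁) * χ (l₁ : ZMod D) *
                DeltaW D (((l₁ * l₂ : ℕ) : ℝ) / ((D : ℝ) * p * k))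
            else 0)
        else 0

/-- **(15.8)** (p. 82, tex L4109; DAG `Z22:(15.8)`): "The innermost sum above is, by the Mellin
transform, equal to `(1/2πi)∫_{(2)} (Σ_{(l₁,d₂k)=1} κ₁(d₁l₁)χ(l₁)l₁^{−s})(Dpk/l₂)^s δ(s) ds`" (`δ` =
`Skeleton.deltaW` (5.14), the Mellin transform of `Δ`). CLAIM. [cite: Zhang2022LandauSiegel, §15 (15.8) p. 82] -/
def Eq15_8 (c' : ℝ) : Prop :=
  ForAllLarge fun D _ χ => ∀ p ∈ primeWindow D, ∀ d₁ d₂ k l₂ : ℕ,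
    0 < d₁ → 0 < d₂ → 0 < k → 0 < l₂ →
      (∑' l₁ : ℕ, if Nat.Coprime l₁ (d₂ * k) then
          kappa1 c' D (d₁ * l₁) * χ (l₁ : ZMod D) *
            DeltaW D (((l₁ * l₂ : ℕ) : ℝ) / ((D : ℝ) * p * k))
        else 0) =
      (1 / (2 * π) : ℂ) * ∫ t : ℝ,
        (∑' l₁ : ℕ, if Nat.Coprime l₁ (d₂ * k) then
            kappa1 c' D (d₁ * l₁) * χ (l₁ : ZMod D) / (l₁ : ℂ) ^ (2 + t * I : ℂ) else 0) *
          ((((D : ℝ) * p * k / l₂ : ℝ)) : ℂ) ^ (2 + t * I : ℂ) * deltaW D (2 + t * I)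

section KappaTilde

variable (c' : ℝ) {D : ℕ} (χ : DirichletCharacter ℂ D)

open scoped Classical in
/-- **`κ̃₁(d₁;r,s) = Σ_{h∈𝔫(d₁),(h,r)=1} κ₁(d₁h)χ(h)h^{−s}`** (p. 82, (15.9), tex L4120; DAG
`Z22:(15.9)`, definition; `𝔫(d)` = `Skeleton.nset`, a series over `h`; `κ̃₁(d;r) := κ̃₁(d;r,1)`).
[cite: Zhang2022LandauSiegel, §15 (15.9) p. 82] -/
def kappaTilde1 (d r : ℕ) (s : ℂ) : ℂ :=
  ∑' h : ℕ, if h ∈ nset d ∧ Nat.Coprime h r then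
    kappa1 c' D (d * h) * χ (h : ZMod D) / (h : ℂ) ^ s else 0

/-- **`λ₁(n,s) = ∏_{q∣n} (1 − χ(q)q^{−s−β₁})(1 − χ(q)q^{−s−β₂})/(1 − χ(q)q^{−s})`** (p. 82, (15.10),
tex L4124; DAG `Z22:(15.10)`, definition; `λ₁(n) := λ₁(n,1)`). [cite: Zhang2022LandauSiegel, §15 (15.10) p. 82] -/
def lam1 (n : ℕ) (s : ℂ) : ℂ :=
  ∏ q ∈ n.primeFactors,
    (1 - χ (q : ZMod D) * (q : ℂ) ^ (-(s + beta1 c' D))) *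
        (1 - χ (q : ZMod D) * (q : ℂ) ^ (-(s + beta2 c' D))) /
      (1 - χ (q : ZMod D) * (q : ℂ) ^ (-s))

variable [NeZero D]

/-- **`𝓡₁* = L(1+β₁,χ)L(1+β₂,χ)δ(1)/L′(1,χ)`** (p. 83, tex L4135; DAG `Z22:§15.u022`, step-def): the
residue datum of u021 after replacing `ρ̃` by `1` ((5.15)). [cite: Zhang2022LandauSiegel, §15 p. 83] -/
def calR1star : ℂ :=
  χ.LFunction (1 + beta1 c' D) * χ.LFunction (1 + beta2 c' D) / deriv χ.LFunction 1 * deltaW D 1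

/-- **`𝔇₁(d,l) = Σ_{(k,l)=1} μχ(k)/φ(k) Σ_m κ̃₁(m;dk)λ₁(mdk)g̃₃(mdk)/m`** (p. 83, tex L4158; DAG
`Z22:§15.u025`, step-def; `k, m ≤ 2P₄` since `g̃₃(mdk) = 0` beyond). [cite: Zhang2022LandauSiegel, §15 p. 83] -/
def calD1 (d l : ℕ) : ℂ :=
  ∑ k ∈ (Finset.Icc 1 ⌊2 * P4 D⌋₊).filter (fun k => Nat.Coprime k l),
    (ArithmeticFunction.moebius k : ℂ) * χ (k : ZMod D) / (Nat.totient k : ℂ) *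
      ∑ m ∈ Finset.Icc 1 ⌊2 * P4 D⌋₊,
        kappaTilde1 c' χ m (d * k) 1 * lam1 c' χ (m * d * k) 1 *
          gtilde3 c' D ((m * d * k : ℕ) : ℝ) / (m : ℂ)

end KappaTilde

/-- **§15 p. 82, tex L4114 (DAG `Z22:§15.u020`)**: "Every `l₁` can be uniquely written as `l₁ = hl` such
that `h ∈ 𝔫(d₁)` and `(l, d₁) = 1`, so that `κ₁(d₁l₁) = κ₁(d₁h)κ₁(l)`. Hence, for `σ > 1`,
`Σ_{(l₁,d₂k)=1} κ₁(d₁l₁)χ(l₁)l₁^{−s} = κ̃₁(d₁;d₂k,s) Σ_{(l,d₁d₂k)=1} κ₁(l)χ(l)l^{−s}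
= κ̃₁(d₁;d₂k,s)λ₁(d₁d₂k,s)L(s+β₁,χ)L(s+β₂,χ)/L(s,χ)`" (both equalities). CLAIM.
[cite: Zhang2022LandauSiegel, §15 p. 82] -/
def Step15_u020 (c' : ℝ) : Prop :=
  ∀ (D : ℕ) [NeZero D] (χ : DirichletCharacter ℂ D) (d₁ d₂ k : ℕ) (s : ℂ),
    0 < d₁ → 0 < d₂ → 0 < k → 1 < s.re →
      let S : ℂ := ∑' l₁ : ℕ, if Nat.Coprime l₁ (d₂ * k) then
          kappa1 c' D (d₁ * l₁) * χ (l₁ : ZMod D) / (l₁ : ℂ) ^ s else 0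
      S = kappaTilde1 c' χ d₁ (d₂ * k) s *
            ∑' l : ℕ, (if Nat.Coprime l (d₁ * d₂ * k) then
              kappa1 c' D l * χ (l : ZMod D) / (l : ℂ) ^ s else 0) ∧
        S = kappaTilde1 c' χ d₁ (d₂ * k) s * lam1 c' χ (d₁ * d₂ * k) s *
            (χ.LFunction (s + beta1 c' D) * χ.LFunction (s + beta2 c' D) / χ.LFunction s)

/-- **§15 p. 82, tex L4129 (DAG `Z22:§15.u021`)**: "Note that `Dpk/l₂ > T` if `l₂ < PT⁻²`. In a way
similar to the treatment of (7.19), by Lemma 5.5, we see that the expression (15.8) is equal to the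
residue of the integrand at `s = ρ̃` plus an acceptable error. Further, by (5.15), in the expression
for this residue, we can replace `ρ̃` by `1` with an acceptable error. Thus we have
`Σ_{(l₁,d₂k)=1} κ₁(d₁l₁)χ(l₁)Δ(l₁l₂/(Dpk)) = 𝓡₁*(Dpk/l₂)κ̃₁(d₁;d₂k)λ₁(d₁d₂k) + O(α¹⁰⁰τ₃(d₁)Dpk/l₂)`"
(`p ∼ P`, `d₁d₂k < 2P₄`, `l₂ < PT⁻²`; under (A)). CLAIM. [cite: Zhang2022LandauSiegel, §15 p. 82] -/
def Step15_u021 (c' : ℝ) : Prop :=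
  ∃ C : ℝ, ForAllLarge fun D _ χ => AssumptionA D χ → ∀ p ∈ primeWindow D, ∀ d₁ d₂ k l₂ : ℕ,
    0 < d₁ → 0 < d₂ → 0 < k → 0 < l₂ → ((d₁ * d₂ * k : ℕ) : ℝ) < 2 * P4 D →
      (l₂ : ℝ) < bigP D / bigT D ^ 2 →
        ‖(∑' l₁ : ℕ, if Nat.Coprime l₁ (d₂ * k) then
              kappa1 c' D (d₁ * l₁) * χ (l₁ : ZMod D) *
                DeltaW D (((l₁ * l₂ : ℕ) : ℝ) / ((D : ℝ) * p * k)) else 0) -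
            calR1star c' χ * ((((D : ℝ) * p * k / l₂ : ℝ)) : ℂ) *
              kappaTilde1 c' χ d₁ (d₂ * k) 1 * lam1 c' χ (d₁ * d₂ * k) 1‖ ≤
          C * alpha D ^ 100 * MeanSquareMajorant.tau 3 d₁ * ((D : ℝ) * p * k / l₂)

/-- **§15 p. 83, tex L4139 (DAG `Z22:§15.u023`)**: "This yields `Σ_{(l,k)=1} (κ₁∗b)(dl)χ(l)Δ(l/(Dpk))
= 𝓡₁* Dpk Σ_{d=d₁d₂} κ̃₁(d₁;d₂k)λ₁(dk) Σ_{(l₂,k)=1} b(d₂l₂)χ(l₂)/l₂ + O(α⁵⁰τ₃(d₁)Dpk)`" (`p ∼ P`,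
`dk < 2P₄`; the printed error term carries the bound variable `d₁` — typed with `τ₃(d) ≥ τ₃(d₁)`,
FLAGGED), for a coefficient family `b` (printed `b = bLit`). CLAIM. [cite: Zhang2022LandauSiegel, §15 p. 83] -/
def Step15_u023 (c' : ℝ) (b : CoefFam) : Prop :=
  ∃ C : ℝ, ForAllLarge fun D _ χ => AssumptionA D χ → ∀ p ∈ primeWindow D, ∀ d k : ℕ,
    0 < d → 0 < k → ((d * k : ℕ) : ℝ) < 2 * P4 D →
      ‖(∑' l : ℕ, if Nat.Coprime l k then
            kappaStar1 c' D (b D χ) (d * l) * χ (l : ZMod D) * DeltaW D ((l : ℝ) / ((D : ℝ) * p * k))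
          else 0) -
          calR1star c' χ * ((D : ℂ) * p * k) *
            ∑ dd ∈ d.divisorsAntidiagonal,
              kappaTilde1 c' χ dd.1 (dd.2 * k) 1 * lam1 c' χ (d * k) 1 *
                ∑' l₂ : ℕ, (if Nat.Coprime l₂ k then
                  b D χ (dd.2 * l₂) * χ (l₂ : ZMod D) / (l₂ : ℂ) else 0)‖
        ≤ C * alpha D ^ 50 * MeanSquareMajorant.tau 3 d * ((D : ℝ) * p * k)

/-- **§15 p. 83, tex L4147 (DAG `Z22:§15.u024`)**: "Hence `Σ_d g̃₃(dk)/d Σ_{(l,k)=1}(κ₁∗b)(dl)χ(l)Δ(l/(Dpk))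
= 𝓡₁* Dpk Σ_{d₁}Σ_{d₂} g̃₃(d₁d₂k)/(d₁d₂)·κ̃₁(d₁;d₂k)λ₁(d₁d₂k) Σ_{(l₂,k)=1} b(d₂l₂)χ(l₂)/l₂ + O(α³⁰Dpk)`"
(`p ∼ P`; `d, d₁, d₂ ≤ 2P₄`), for a coefficient family `b` (printed `b = bLit`). CLAIM.
[cite: Zhang2022LandauSiegel, §15 p. 83] -/
def Step15_u024 (c' : ℝ) (b : CoefFam) : Prop :=
  ∃ C : ℝ, ForAllLarge fun D _ χ => AssumptionA D χ → ∀ p ∈ primeWindow D, ∀ k : ℕ, 0 < k →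
    ‖(∑ d ∈ Finset.Icc 1 ⌊2 * P4 D⌋₊, gtilde3 c' D ((d * k : ℕ) : ℝ) / (d : ℂ) *
          ∑' l : ℕ, if Nat.Coprime l k then
            kappaStar1 c' D (b D χ) (d * l) * χ (l : ZMod D) * DeltaW D ((l : ℝ) / ((D : ℝ) * p * k))
          else 0) -
        calR1star c' χ * ((D : ℂ) * p * k) *
          ∑ d₁ ∈ Finset.Icc 1 ⌊2 * P4 D⌋₊, ∑ d₂ ∈ Finset.Icc 1 ⌊2 * P4 D⌋₊,
            gtilde3 c' D ((d₁ * d₂ * k : ℕ) : ℝ) / ((d₁ : ℂ) * d₂) *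
              kappaTilde1 c' χ d₁ (d₂ * k) 1 * lam1 c' χ (d₁ * d₂ * k) 1 *
                ∑' l₂ : ℕ, (if Nat.Coprime l₂ k then
                  b D χ (d₂ * l₂) * χ (l₂ : ZMod D) / (l₂ : ℂ) else 0)‖
      ≤ C * alpha D ^ 30 * ((D : ℝ) * p * k)

/-- **(15.11)** (p. 83, tex L4154; DAG `Z22:(15.11)`): "Inserting this into (15.7) and rewriting `d`, `l`
and `m` for `d₂`, `l₂` and `d₁` respectively, we obtain
`Φ₁(p) = (𝓡₁*Dp/φ(D)) Σ_d Σ_l b(dl)χ(l)/(dl)·𝔇₁(d,l) + o(P)`" (`p ∼ P`; the `d, l`-sums finite: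
`b(dl) = 0` for `dl > PT⁻²η₊`, here run over `1 ≤ d, l ≤ ⌊P⌋`), for a coefficient family `b` (printed
`b = bLit`, with `Φ₁(p) = Phi1pOf … (b D χ)`). CLAIM. [cite: Zhang2022LandauSiegel, §15 (15.11) p. 83] -/
def Eq15_11 (c' : ℝ) (b : CoefFam) : Prop :=
  ∀ ε : ℝ, 0 < ε → ForAllLarge fun D _ χ => AssumptionA D χ → ∀ p ∈ primeWindow D,
    ‖Phi1pOf c' χ (b D χ) p -
        calR1star c' χ * (D : ℂ) * p / (Nat.totient D : ℂ) *
          ∑ d ∈ Finset.Icc 1 ⌊bigP D⌋₊, ∑ l ∈ Finset.Icc 1 ⌊bigP D⌋₊,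
            b D χ (d * l) * χ (l : ZMod D) / ((d : ℂ) * l) * calD1 c' χ d l‖ ≤ ε * bigP D

/-! ## Kernel-checked nodes and bridges (no new facts)

The claims above that are identities of the tree's objects are discharged here; the bridge
`sum_Phi1pOf_eq_main141` identifies `Σ_{p∼P} Φ₁(p)` with the main term of Proposition 14.1 at
`β = 0`, `𝐤* = κ₁*`, `𝐚* = a₁*` (the step "It follows by (15.3)–(15.5) and Proposition 14.1 that
(15.6)"). -/

section Discharges

-- `β_j = ib_j` (the skeleton's `beta_j` versus the real sizes `b_j`) is rewritten locally below
-- (`have hβ₁ …`); the named lemmas live in `Typed.Section16A` (`beta1_eq_b1_mul_I` etc.), which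
-- this file does not import to keep the §15 ← §16 import direction free.

/-- **`Z22:§15.u013` DISCHARGED**: the defining display of `κ₁` holds for the object `kappa1`
(the tree's `MeanSquareMajorant.LSeries_kappa₁`, `β_j = ib_j`). [cite: Zhang2022LandauSiegel, §15 p. 81] -/
theorem step15_u013_holds (c' : ℝ) : Step15_u013 c' := by
  intro D s hs
  have hβ₁ : beta1 c' D = (b1 c' D : ℂ) * I := by simp only [beta1, b1]; push_cast; ring
  have hβ₂ : beta2 c' D = (b2 c' D : ℂ) * I := by simp only [beta2, b2]; push_cast; ring
  have key := MeanSquareMajorant.LSeries_kappa₁ (b1 c' D) (b2 c' D) hs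
  rw [hβ₁, hβ₂, ← key, LSeries]
  refine tsum_congr fun m => ?_
  rcases eq_or_ne m 0 with rfl | hm
  · simp [kappa1]
  · rw [LSeries.term_of_ne_zero hm]
    rfl

/-- **`Z22:§15.u015` DISCHARGED**: `K(1−s−β₃,ψ̄) = Σ_n g̃₃(n)ψ̄(n)n^{s−1}` — unfolding `Skeleton.Kchar`
(a finite sum over `1 ≤ n < ⌈2P₄⌉`, `g*(P₄/n) = 0` beyond) and `n^{−(1−s−β₃)} = n^{β₃}/n^{1−s}`.
[cite: Zhang2022LandauSiegel, §15 p. 81] -/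
theorem step15_u015_holds (c' : ℝ) : Step15_u015 c' := by
  intro D x s
  rw [Kchar]
  symm
  rw [tsum_eq_sum (s := Finset.Ico 1 ⌈2 * P4 D⌉₊)]
  · refine Finset.sum_congr rfl fun n hn => ?_
    have hn1 : 1 ≤ n := (Finset.mem_Ico.mp hn).1
    have hn0 : (n : ℂ) ≠ 0 := by exact_mod_cast (show n ≠ 0 by omega)
    have hpow : (n : ℂ) ^ (-(1 - s - beta3 c' D)) = (n : ℂ) ^ beta3 c' D / (n : ℂ) ^ (1 - s) := by
      rw [show -(1 - s - beta3 c' D) = beta3 c' D - (1 - s) by ring, Complex.cpow_sub _ _ hn0]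
    rw [hpow, gtilde3, psiBarFn]
    push_cast
    ring
  · intro n hn
    rw [Finset.mem_Ico, not_and_or, not_le, not_lt] at hn
    rcases hn with hn | hn
    · have : n = 0 := by omega
      subst this
      simp [gtilde3, gstar]
    · have h2 : 2 * P4 D ≤ n := Nat.ceil_le.mp hn
      have hg : gstar D (P4 D / n) = 0 := by
        rw [gstar, if_neg]
        rcases Nat.eq_zero_or_pos n with rfl | hpos
        · simp
        · have hn' : (0 : ℝ) < n := by exact_mod_cast hpos
          rw [not_lt, div_le_iff₀ hn']
          linarith
      simp [gtilde3, hg]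

/-- **`Σ_{p∼P} Φ₁(p)` is the main term of Proposition 14.1 at `β = 0`, `𝐤* = κ₁ ∗ b`, `𝐚* = g̃₃`**
(for any coefficient sequence `b`): the bookkeeping behind "It follows by (15.3)–(15.5) and
Proposition 14.1 that (15.6)" (`(pt₀)⁰ = 1`, the `d`- and `k`-sums exchanged). Kernel-checked.
[cite: Zhang2022LandauSiegel, §15 (15.6)–(15.7) pp. 81–82] -/
theorem sum_Phi1pOf_eq_main141 (c' : ℝ) {D : ℕ} [NeZero D] (χ : DirichletCharacter ℂ D)
    (b : ℕ → ℂ) :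
    ∑ p ∈ primeWindow D, Phi1pOf c' χ b p = main141 χ 0 (kappaStar1 c' D b) (aStar1 c' D) := by
  have hL : ∀ (p d k : ℕ),
      (∑' l : ℕ, if Nat.Coprime l k then
          kappaStar1 c' D b (d * l) * χ (l : ZMod D) * DeltaW D ((l : ℝ) / ((D : ℝ) * p * k))
        else 0) =
        ∑' l : ℕ, if Nat.Coprime l k then
          χ (l : ZMod D) * kappaStar1 c' D b (d * l) * DeltaW D ((l : ℝ) / ((D : ℝ) * p * k))
        else 0 := by
    intro p d k
    refine tsum_congr fun l => ?_
    split_ifs <;> ring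
  simp only [Phi1pOf, main141, aStar1]
  simp_rw [hL]
  simp only [cpow_zero, one_mul, Finset.mul_sum]
  refine Finset.sum_congr rfl fun p _ => ?_
  rw [Finset.sum_comm]
  refine Finset.sum_congr rfl fun d _ => Finset.sum_congr rfl fun k _ => ?_
  ring

/-- The printed instance: `Σ_{p∼P} Φ₁(p) = [main term of Prop. 14.1](0, κ₁∗b, g̃₃)` with
`b = Skeleton.bcoef`. [cite: Zhang2022LandauSiegel, §15 (15.6)–(15.7) pp. 81–82] -/
theorem sum_Phi1p_eq_main141 (c' : ℝ) {D : ℕ} [NeZero D] (χ : DirichletCharacter ℂ D) :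
    ∑ p ∈ primeWindow D, Phi1p c' χ p =
      main141 χ 0 (kappaStar1 c' D (bcoef D)) (aStar1 c' D) :=
  sum_Phi1pOf_eq_main141 c' χ (bcoef D)

end Discharges

section Eq152

/-- `3 ≤ log D` once `D ≥ 21` (`e³ < 20.09`). [folklore] -/
private theorem three_le_log_of_le {D : ℕ} (hD : 21 ≤ D) : 3 ≤ Real.log D := by
  have hD' : (21 : ℝ) ≤ D := by exact_mod_cast hD
  have h3 : Real.exp 3 ≤ 21 := by
    have he : Real.exp 3 = Real.exp 1 ^ 3 := by
      rw [← Real.exp_nat_mul]; norm_num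
    have h1 : Real.exp 1 ^ 3 < (2.7182818286 : ℝ) ^ 3 := by
      gcongr
      exact Real.exp_one_lt_d9
    rw [he]
    have h2 : (2.7182818286 : ℝ) ^ 3 < 21 := by norm_num
    linarith
  exact (Real.le_log_iff_exp_le (by linarith)).mpr (h3.trans hD')

/-- `𝓛^{1.1} ≤ 10⁻³𝓛⁹` for `𝓛 ≥ 3` (`𝓛⁹ = 𝓛^{1.1}𝓛^{7.9}`, `𝓛^{7.9} ≥ 3⁷ = 2187`). [folklore] -/
private theorem ell_rpow_le {L : ℝ} (hL : 3 ≤ L) : L ^ (1.1 : ℝ) ≤ (1 / 1000) * L ^ 9 := by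
  have hL0 : 0 < L := by linarith
  have hL1 : 1 ≤ L := by linarith
  have h9 : L ^ 9 = L ^ (1.1 : ℝ) * L ^ (7.9 : ℝ) := by
    rw [← Real.rpow_add hL0, show (1.1 : ℝ) + 7.9 = (9 : ℕ) by norm_num, Real.rpow_natCast]
  have h79 : (1000 : ℝ) ≤ L ^ (7.9 : ℝ) := by
    calc (1000 : ℝ) ≤ 3 ^ 7 := by norm_num
      _ ≤ L ^ 7 := by gcongr
      _ = L ^ (7 : ℝ) := by rw [show (7 : ℝ) = (7 : ℕ) by norm_num, Real.rpow_natCast]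
      _ ≤ L ^ (7.9 : ℝ) := Real.rpow_le_rpow_of_exponent_le hL1 (by norm_num)
  have hpos : 0 ≤ L ^ (1.1 : ℝ) := Real.rpow_nonneg hL0.le _
  rw [h9]
  nlinarith

/-- **`Z22:(15.2)` DISCHARGED**: `b(n) ≪ τ₂(n)` with the constant `(1 + |ι₂|)(|ι₃| + |ι₄|)` (two
bounded-coefficient factors, the tree's `MeanSquareMajorant.norm_seqConv_le_tau_two` with
`|ϰⱼ(n)| ≤ 1`, `Skeleton.norm_vk1_le` etc.), and `b(n) = 0` for `n > PT⁻²η₊` (indeed for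
`n ≥ P^{1/2}·max(P₂,P₃)`: the first factor of `b` lives on `a < P^{1/2}`, the second on
`b < max(P₂, P₃) ≤ P^{1/2}T⁻²η₊` once `𝓛 ≥ 3`), for `D ≥ 21`. [cite: Zhang2022LandauSiegel, §15 (15.2) p. 79] -/
theorem eq15_2_holds : Eq15_2 := by
  refine ⟨(1 + ‖iota2‖) * (‖iota3‖ + ‖iota4‖), 21, fun D _ χ hD _ _ => ?_⟩
  have hlog3 : 3 ≤ Real.log D := three_le_log_of_le hD
  have hlog2 : 2 ≤ Real.log D := by linarith
  constructor
  · intro n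
    have hb : bcoef D n = MeanSquareMajorant.seqConv
        (fun a => (if (a : ℝ) < bigP D ^ (1 / 2 : ℝ) then vk1 D a else 0) + iota2 * vk2 D a)
        (fun b => conj iota3 * vk3 D b + conj iota4 * vk2 D b) n := rfl
    rw [hb]
    refine MeanSquareMajorant.norm_seqConv_le_tau_two (by positivity) ?_ ?_ n
    · intro a _
      calc ‖(if (a : ℝ) < bigP D ^ (1 / 2 : ℝ) then vk1 D a else 0) + iota2 * vk2 D a‖
          ≤ ‖(if (a : ℝ) < bigP D ^ (1 / 2 : ℝ) then vk1 D a else 0)‖ + ‖iota2 * vk2 D a‖ :=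
            norm_add_le _ _
        _ ≤ 1 + ‖iota2‖ * 1 := by
            gcongr
            · split_ifs
              · exact norm_vk1_le hlog2 a
              · simp
            · rw [norm_mul]
              gcongr
              exact norm_vk2_le hlog2 a
        _ = 1 + ‖iota2‖ := by ring
    · intro b _
      calc ‖conj iota3 * vk3 D b + conj iota4 * vk2 D b‖
          ≤ ‖conj iota3 * vk3 D b‖ + ‖conj iota4 * vk2 D b‖ := norm_add_le _ _
        _ ≤ ‖iota3‖ * 1 + ‖iota4‖ * 1 := by
            rw [norm_mul, norm_mul, Complex.norm_conj, Complex.norm_conj]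
            gcongr
            · exact norm_vk3_le hlog2 b
            · exact norm_vk2_le hlog2 b
        _ = ‖iota3‖ + ‖iota4‖ := by ring
  · intro n hn
    rw [bcoef]
    refine Finset.sum_eq_zero fun x hx => ?_
    obtain ⟨hprod, hn0⟩ := Nat.mem_divisorsAntidiagonal.mp hx
    have hℓ : 3 ≤ ell D := hlog3
    have hℓpos : 0 < ell D := by linarith
    have hT1 : 1 ≤ bigT D := by
      rw [bigT]; exact Real.one_le_exp (Real.rpow_nonneg hℓpos.le _)
    have hT0 : 0 < bigT D := by linarith
    have hP0 : 0 < bigP D := Real.exp_pos _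
    have hPh : 0 < bigP D ^ (1 / 2 : ℝ) := Real.rpow_pos_of_pos hP0 _
    have hη : 1 ≤ etaPM D 1 := by
      rw [etaPM]; exact Real.one_le_exp (by positivity)
    have hP2 : Skeleton.P2 D ≤ bigP D ^ (1 / 2 : ℝ) := by
      rw [Skeleton.P2, show (0.5 : ℝ) = 1 / 2 by norm_num]
      exact div_le_self hPh.le (one_le_pow₀ hT1)
    -- the threshold for the second factor
    have hthr2 : Skeleton.P2 D ≤ bigP D ^ (1 / 2 : ℝ) * etaPM D 1 / bigT D ^ 2 := by
      rw [Skeleton.P2, show (0.5 : ℝ) = 1 / 2 by norm_num]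
      have h10 : bigT D ^ 2 ≤ bigT D ^ 10 := pow_le_pow_right₀ hT1 (by norm_num)
      calc bigP D ^ (1 / 2 : ℝ) / bigT D ^ 10 ≤ bigP D ^ (1 / 2 : ℝ) / bigT D ^ 2 :=
            div_le_div_of_nonneg_left hPh.le (by positivity) h10
        _ = bigP D ^ (1 / 2 : ℝ) * 1 / bigT D ^ 2 := by rw [mul_one]
        _ ≤ bigP D ^ (1 / 2 : ℝ) * etaPM D 1 / bigT D ^ 2 := by gcongr
    have hthr3 : Skeleton.P3 D ≤ bigP D ^ (1 / 2 : ℝ) * etaPM D 1 / bigT D ^ 2 := by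
      -- `P^{0.498}T² ≤ P^{1/2}`: `0.498𝓛⁹ + 2𝓛^{1.1} ≤ 𝓛⁹/2`
      have hkey : bigP D ^ (0.498 : ℝ) * bigT D ^ 2 ≤ bigP D ^ (1 / 2 : ℝ) := by
        rw [bigP, bigT, ← Real.exp_mul, ← Real.exp_mul, ← Real.exp_nat_mul, ← Real.exp_add]
        refine Real.exp_le_exp.mpr ?_
        have := ell_rpow_le hℓ
        push_cast
        nlinarith
      calc Skeleton.P3 D = bigP D ^ (0.498 : ℝ) * bigT D ^ 2 / bigT D ^ 2 := by
            rw [Skeleton.P3, mul_div_assoc, div_self (by positivity), mul_one]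
        _ ≤ bigP D ^ (1 / 2 : ℝ) / bigT D ^ 2 := by gcongr
        _ = bigP D ^ (1 / 2 : ℝ) * 1 / bigT D ^ 2 := by rw [mul_one]
        _ ≤ bigP D ^ (1 / 2 : ℝ) * etaPM D 1 / bigT D ^ 2 := by gcongr
    by_cases ha : (x.1 : ℝ) < bigP D ^ (1 / 2 : ℝ)
    · -- the cofactor `x.2` exceeds `P^{1/2}η₊T⁻²`, hence `P₂` and `P₃`
      have ha0 : x.1 ≠ 0 := fun h => hn0 (by rw [← hprod, h, zero_mul])
      have ha' : (0 : ℝ) < x.1 := by exact_mod_cast Nat.pos_of_ne_zero ha0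
      have hPP : bigP D = bigP D ^ (1 / 2 : ℝ) * bigP D ^ (1 / 2 : ℝ) := by
        rw [← Real.rpow_add hP0]; norm_num
      have h2 : bigP D / bigT D ^ 2 * etaPM D 1 < x.2 * x.1 := by
        have : (n : ℝ) = x.2 * x.1 := by rw [← hprod]; push_cast; ring
        rw [← this]; exact hn
      have h3 : bigP D ^ (1 / 2 : ℝ) * etaPM D 1 / bigT D ^ 2 * x.1 <
          bigP D / bigT D ^ 2 * etaPM D 1 := by
        have hc : 0 < etaPM D 1 / bigT D ^ 2 := by
          have : 0 < etaPM D 1 := by linarith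
          positivity
        calc bigP D ^ (1 / 2 : ℝ) * etaPM D 1 / bigT D ^ 2 * x.1
            = etaPM D 1 / bigT D ^ 2 * (bigP D ^ (1 / 2 : ℝ) * x.1) := by ring
          _ < etaPM D 1 / bigT D ^ 2 * (bigP D ^ (1 / 2 : ℝ) * bigP D ^ (1 / 2 : ℝ)) := by
              gcongr
          _ = bigP D / bigT D ^ 2 * etaPM D 1 := by rw [← hPP]; ring
      have hb : bigP D ^ (1 / 2 : ℝ) * etaPM D 1 / bigT D ^ 2 < x.2 :=
        lt_of_mul_lt_mul_right (h3.trans h2) ha'.le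
      have hv3 : vk3 D x.2 = 0 := vk3_eq_zero (hthr3.trans hb.le)
      have hv2 : vk2 D x.2 = 0 := vk2_eq_zero (hthr2.trans hb.le)
      rw [hv3, hv2]
      ring
    · -- `x.1 ≥ P^{1/2} ≥ P₂`: the first factor vanishes
      rw [if_neg ha, vk2_eq_zero (hP2.trans (not_lt.mp ha))]
      ring

end Eq152

/-! ## The edge (15.3) + (15.4) + (15.5) + Proposition 14.1 ⇒ (15.6), kernel-checked

For any coefficient family `b ≪ τ₂` (so for the printed `bLit` by `eq15_2_holds`, and for `bChi`):
`κ₁* = κ₁ ∗ b ≪ τ₅` (14.1) and `a₁* = g̃₃ ≪ 1`, `a₁*(n) = 0` for `n > 2P₄` (14.2), so Proposition 14.1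
applies at `β = 0`; the two `O(ε)` terms (`ε = exp{−c𝓛¹⁰}`) are `o(𝔓)` because `𝔓 ≥ 1` eventually
((2.9), the tree's `frakP_bounds`). -/

section Edge156

/-- `L₀ ≤ log D` once `D ≥ ⌈exp L₀⌉₊`. [folklore] -/
private theorem le_log_of_ceil_exp_le {L₀ : ℝ} {D : ℕ} (hD : ⌈Real.exp L₀⌉₊ ≤ D) :
    L₀ ≤ Real.log D := by
  have h : Real.exp L₀ ≤ D := le_trans (Nat.le_ceil _) (by exact_mod_cast hD)
  exact (Real.le_log_iff_exp_le (lt_of_lt_of_le (Real.exp_pos _) h)).mpr h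

/-- Zhang's negligible `ε = exp{−c𝓛¹⁰}` times any constant is eventually below any `η > 0`
(`exp(c𝓛¹⁰) ≥ 1 + c𝓛¹⁰ ≥ c𝓛`; the same computation as in the tree's `Section8aStatements`).
[cite: Zhang2022LandauSiegel, §4 p. 17, tex L1062] -/
private theorem exp_neg_eventually_le {c : ℝ} (hc : 0 < c) (C η : ℝ) (hη : 0 < η) :
    ∃ D₀ : ℕ, ∀ D : ℕ, D₀ ≤ D → C * Real.exp (-c * ell D ^ 10) ≤ η := by
  refine ⟨⌈Real.exp (max 1 ((|C| + 1) / (c * η)))⌉₊, fun D hD => ?_⟩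
  have hℓ : max 1 ((|C| + 1) / (c * η)) ≤ ell D := le_log_of_ceil_exp_le hD
  have hℓ1 : 1 ≤ ell D := le_trans (le_max_left _ _) hℓ
  have hℓ2 : (|C| + 1) / (c * η) ≤ ell D := le_trans (le_max_right _ _) hℓ
  have hℓ10 : ell D ≤ ell D ^ 10 := by
    calc ell D = ell D ^ 1 := (pow_one _).symm
      _ ≤ ell D ^ 10 := pow_le_pow_right₀ hℓ1 (by norm_num)
  have hE := Real.add_one_le_exp (c * ell D ^ 10)
  have hCle : |C| + 1 ≤ ell D * (c * η) := (div_le_iff₀ (by positivity)).mp hℓ2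
  have hEpos : 0 < Real.exp (c * ell D ^ 10) := Real.exp_pos _
  have hmono : η * c * ell D ≤ η * c * ell D ^ 10 :=
    mul_le_mul_of_nonneg_left hℓ10 (by positivity)
  rw [neg_mul, Real.exp_neg, ← div_eq_mul_inv, div_le_iff₀ hEpos]
  calc C ≤ |C| := le_abs_self C
    _ ≤ η * c * ell D - 1 := by linarith
    _ ≤ η * (c * ell D ^ 10) := by linarith
    _ ≤ η * Real.exp (c * ell D ^ 10) := mul_le_mul_of_nonneg_left (by linarith) hη.le

/-- **`𝔓 ≥ 1` for large `D`** ((2.9): `𝔓 = (1 + O(𝓛⁻⁶⁸))P²𝓛⁻⁷⁷`, the tree's `frakP_bounds`, and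
`P² = exp(2𝓛⁹) ≥ (2𝓛⁹)⁹/9! ≥ 2𝓛⁷⁷` once `𝓛 ≥ 7`; the same computation as in the tree's
`Section8aStatements`). [cite: Zhang2022LandauSiegel, §2 (2.9) p. 4] -/
private theorem one_le_frakP_eventually : ∃ D₀ : ℕ, ∀ D : ℕ, D₀ ≤ D → 1 ≤ frakP D := by
  obtain ⟨D₀, h⟩ := frakP_bounds
  refine ⟨max D₀ ⌈Real.exp 7⌉₊, fun D hD => ?_⟩
  have hD₀ : D₀ ≤ D := le_trans (le_max_left _ _) hD
  have hL7 : (7 : ℝ) ≤ Real.log D := le_log_of_ceil_exp_le (le_trans (le_max_right _ _) hD)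
  set L := Real.log D with hL
  set M := Real.exp (L ^ 9) ^ 2 * (L ^ 77)⁻¹ with hM
  have hL0 : 0 < L := by linarith
  have hL77 : 0 < L ^ 77 := by positivity
  have hb := abs_le.mp (h D hD₀)
  have hL68 : 6 ≤ L ^ 68 := by
    calc (6 : ℝ) ≤ 7 ^ 1 := by norm_num
      _ ≤ L ^ 1 := by rw [pow_one, pow_one]; exact hL7
      _ ≤ L ^ 68 := pow_le_pow_right₀ (by linarith) (by norm_num)
  have hsmall : 3 * (L ^ 68)⁻¹ ≤ 1 / 2 := by
    rw [inv_eq_one_div, mul_one_div, div_le_iff₀ (by positivity)]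
    linarith
  have hL4 : (2401 : ℝ) ≤ L ^ 4 := by
    have := pow_le_pow_left₀ (by norm_num : (0 : ℝ) ≤ 7) hL7 4
    linarith [show (7 : ℝ) ^ 4 = 2401 by norm_num]
  have key : 2 * L ^ 77 ≤ Real.exp (L ^ 9) ^ 2 := by
    have h1 : (2 * L ^ 9) ^ 9 / (Nat.factorial 9 : ℝ) ≤ Real.exp (2 * L ^ 9) :=
      Real.pow_div_factorial_le_exp (2 * L ^ 9) (by positivity) 9
    have h2 : Real.exp (L ^ 9) ^ 2 = Real.exp (2 * L ^ 9) := by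
      rw [← Real.exp_nat_mul]; norm_num
    have h3 : (Nat.factorial 9 : ℝ) = 362880 := by norm_num [Nat.factorial]
    rw [h2]
    refine le_trans ?_ h1
    rw [h3, le_div_iff₀ (by norm_num)]
    calc 2 * L ^ 77 * 362880 = 725760 * L ^ 77 := by ring
      _ ≤ 512 * L ^ 4 * L ^ 77 := by nlinarith
      _ = (2 * L ^ 9) ^ 9 := by ring
  have hM2 : 2 ≤ M := by
    rw [hM, ← div_eq_mul_inv, le_div_iff₀ hL77]
    exact key
  nlinarith [hb.1, hsmall, hM2, mul_nonneg (by linarith : (0:ℝ) ≤ 1 / 2 - 3 * (L ^ 68)⁻¹)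
    (by linarith : (0:ℝ) ≤ M)]

/-- Pointwise domination passes through Dirichlet convolution of arithmetic functions.
[folklore] -/
private theorem norm_mul_apply_le {f g : ArithmeticFunction ℂ} {F G : ArithmeticFunction ℝ}
    (hf : ∀ n, ‖f n‖ ≤ F n) (hg : ∀ n, ‖g n‖ ≤ G n) (n : ℕ) : ‖(f * g) n‖ ≤ (F * G) n := by
  rw [ArithmeticFunction.mul_apply, ArithmeticFunction.mul_apply]
  refine (norm_sum_le _ _).trans (Finset.sum_le_sum fun x _ => ?_)
  rw [norm_mul]
  exact mul_le_mul (hf _) (hg _) (norm_nonneg _) ((norm_nonneg _).trans (hf _))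

/-- `|n^{−ib}| ≤ ζ(n)` (`= 1` for `n ≥ 1`, `0` at `0`). [folklore] -/
private theorem norm_powI_le_zeta (b : ℝ) (n : ℕ) :
    ‖MeanSquareMajorant.powI b n‖ ≤ (ArithmeticFunction.zeta : ArithmeticFunction ℝ) n := by
  rcases Nat.eq_zero_or_pos n with rfl | hn
  · simp
  · rw [MeanSquareMajorant.norm_powI_of_pos b hn, ArithmeticFunction.natCoe_apply,
      ArithmeticFunction.zeta_apply_ne hn.ne']
    simp

/-- `|μ(n)| ≤ ζ(n)`. [folklore] -/
private theorem norm_moebius_le_zeta (n : ℕ) :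
    ‖(ArithmeticFunction.moebius : ArithmeticFunction ℂ) n‖ ≤
      (ArithmeticFunction.zeta : ArithmeticFunction ℝ) n := by
  rcases Nat.eq_zero_or_pos n with rfl | hn
  · simp
  · rw [ArithmeticFunction.intCoe_apply, ArithmeticFunction.natCoe_apply,
      ArithmeticFunction.zeta_apply_ne hn.ne', Complex.norm_intCast]
    exact_mod_cast ArithmeticFunction.abs_moebius_le_one

/-- **`|κ₁(n)| ≤ τ₃(n)`** (`κ₁ = n^{−β₁} ∗ n^{−β₂} ∗ μ`, three factors of modulus `≤ 1`).
[cite: Zhang2022LandauSiegel, §15 p. 81] -/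
theorem norm_kappa1_le_tau (c' : ℝ) (D n : ℕ) :
    ‖kappa1 c' D n‖ ≤ MeanSquareMajorant.tau 3 n := by
  have h : MeanSquareMajorant.tau 3 =
      ((ArithmeticFunction.zeta : ArithmeticFunction ℝ) * ArithmeticFunction.zeta) *
        ArithmeticFunction.zeta := by
    rw [MeanSquareMajorant.tau, pow_succ, pow_two]
  rw [h, kappa1, MeanSquareMajorant.kappa₁]
  exact norm_mul_apply_le (norm_mul_apply_le (norm_powI_le_zeta _) (norm_powI_le_zeta _))
    norm_moebius_le_zeta n

/-- `τ_j(n)` (the tree's real `MeanSquareMajorant.tau`) is the cast of `ζ^j(n)` computed in `ℕ`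
(the form in which Proposition 14.1 (14.1) is typed). [folklore] -/
private theorem tau_eq_cast_zeta_pow (j n : ℕ) :
    MeanSquareMajorant.tau j n = (((ArithmeticFunction.zeta ^ j : ArithmeticFunction ℕ)) n : ℝ) := by
  have : ((ArithmeticFunction.zeta ^ j : ArithmeticFunction ℕ) : ArithmeticFunction ℝ) =
      (ArithmeticFunction.zeta : ArithmeticFunction ℝ) ^ j := by
    induction j with
    | zero => rw [pow_zero, pow_zero, ArithmeticFunction.natCoe_one]
    | succ k ih => rw [pow_succ, pow_succ, ArithmeticFunction.natCoe_mul, ih]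
  rw [MeanSquareMajorant.tau, ← this, ArithmeticFunction.natCoe_apply]

/-- **`κ₁* = κ₁ ∗ b ≪ τ₅` (14.1) whenever `b ≪ τ₂`** (`τ₃ ∗ τ₂ = τ₅`, the tree's
`MeanSquareMajorant.norm_seqConv_le_tau`). [cite: Zhang2022LandauSiegel, §14 (14.1), §15 (15.2)] -/
theorem norm_kappaStar1_le (c' : ℝ) (D : ℕ) {b : ℕ → ℂ} {Cb : ℝ}
    (hb : ∀ n, ‖b n‖ ≤ Cb * MeanSquareMajorant.tau 2 n) (m : ℕ) :
    ‖kappaStar1 c' D b m‖ ≤ Cb * MeanSquareMajorant.tau 5 m := by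
  have h := MeanSquareMajorant.norm_seqConv_le_tau (u := fun n => kappa1 c' D n) (v := b)
    (C₁ := 1) (C₂ := Cb) (j₁ := 3) (j₂ := 2) zero_le_one
    (fun n _ => by rw [one_mul]; exact norm_kappa1_le_tau c' D n) (fun n _ => hb n) m
  rw [one_mul] at h
  exact h

/-- **`a₁* = g̃₃ ≪ 1`**: `|g̃₃(y)| ≤ 1` at the integers (`|y^{β₃}| = 1`, `0 ≤ g* < 1`; `𝓛 > 0`).
[cite: Zhang2022LandauSiegel, §14 (14.2), §15 p. 81] -/
theorem norm_gtilde3_le (c' : ℝ) {D : ℕ} (hℓ : 0 < ell D) (n : ℕ) : ‖gtilde3 c' D n‖ ≤ 1 := by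
  rw [gtilde3, norm_mul, Complex.norm_real]
  rcases Nat.eq_zero_or_pos n with rfl | hn
  · have : gstar D (P4 D / ((0 : ℕ) : ℝ)) = 0 := by
      rw [gstar, if_neg]; norm_num
    rw [this]; simp
  · have hn' : (0 : ℝ) < n := by exact_mod_cast hn
    have h1 : ‖((n : ℝ) : ℂ) ^ beta3 c' D‖ = 1 := by
      rw [Complex.norm_cpow_eq_rpow_re_of_pos hn']
      simp [beta3]
    have h2 : ‖gstar D (P4 D / n)‖ ≤ 1 := by
      rw [gstar, Real.norm_eq_abs]
      split_ifs
      · have hΛ : 0 < ell D ^ 30 := by positivity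
        rw [gW, abs_of_pos (GaussWeight.gWeight_pos hΛ _)]
        exact (GaussWeight.gWeight_lt_one hΛ _).le
      · simp
    rw [h1, one_mul]
    exact h2

/-- **`a₁*(n) = 0` for `n > 2P₄`** (14.2) (`g*(P₄/n) = 0` once `P₄/n ≤ 1/2`).
[cite: Zhang2022LandauSiegel, §14 (14.2), §15 p. 81] -/
theorem gtilde3_eq_zero (c' : ℝ) {D n : ℕ} (hn : 2 * P4 D < n) : gtilde3 c' D n = 0 := by
  have hP4 : 0 ≤ P4 D := by
    rw [P4, bigP, bigT, t0]
    have : 0 ≤ ell D := Real.log_natCast_nonneg D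
    positivity
  have hn' : (0 : ℝ) < n := lt_of_le_of_lt (by positivity) hn
  have hg : gstar D (P4 D / n) = 0 := by
    rw [gstar, if_neg]
    rw [not_lt, div_le_iff₀ hn']
    linarith
  rw [gtilde3, hg]
  simp

/-- **EDGE `Z22:(15.6)` ⇐ (15.3), (15.4), (15.5), Proposition 14.1** ("It follows by (15.3)–(15.5) and
Proposition 14.1 that `Φ₁ = Σ_{p∼P} Φ₁(p) + o(𝔓)`"), for every coefficient family `b ≪ τ₂`
(printed: `bLit`, by `eq15_2_holds`): Prop. 14.1 is applied at `β = 0`, `𝐤* = κ₁ ∗ b ≪ τ₅`,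
`𝐚* = g̃₃` (`≪ 1`, vanishing beyond `2P₄`), its main term is `Σ_p Φ₁(p)` (`sum_Phi1pOf_eq_main141`),
and the `O(ε)` terms are absorbed into `o(𝔓)` by `𝔓 ≥ 1`. Kernel-checked; no new facts.
[cite: Zhang2022LandauSiegel, §15 (15.6) p. 81] -/
theorem eq15_6_of (c' : ℝ) (b : CoefFam)
    (hb : ∃ Cb : ℝ, ForAllLarge fun D _ χ => ∀ n, ‖b D χ n‖ ≤ Cb * MeanSquareMajorant.tau 2 n)
    (h3 : Eq15_3 c') (h4 : Eq15_4 c') (h5 : Eq15_5 c' b) (h141 : Prop141) : Eq15_6 c' b := by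
  intro ε hε
  obtain ⟨Cb, hbF⟩ := hb
  obtain ⟨c₃, hc₃, C₃, h3F⟩ := h3
  obtain ⟨c₅, hc₅, C₅, h5F⟩ := h5
  have hε4 : 0 < ε / 4 := by positivity
  have h4F := h4 (ε / 4) hε4
  set B : ℝ := max Cb 1 with hB
  have hCbB : Cb ≤ B := le_max_left _ _
  have h1B : 1 ≤ B := le_max_right _ _
  have h141F := h141 B (ε / 4) hε4
  obtain ⟨D₃, hD₃⟩ := exp_neg_eventually_le hc₃ C₃ (ε / 4) hε4
  obtain ⟨D₅, hD₅⟩ := exp_neg_eventually_le hc₅ C₅ (ε / 4) hε4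
  obtain ⟨D₁, hD₁⟩ := one_le_frakP_eventually
  obtain ⟨D₀, hall⟩ := (((hbF.and h3F).and h4F).and h5F).and h141F
  refine ⟨max (max (max D₀ D₃) (max D₅ D₁)) 8, fun D _ χ hD hq hp hA => ?_⟩
  have hD0 : D₀ ≤ D := le_trans (le_trans (le_max_left _ _) (le_max_left _ _)) (le_trans (le_max_left _ _) hD)
  have hD3 : D₃ ≤ D := le_trans (le_trans (le_max_right _ _) (le_max_left _ _)) (le_trans (le_max_left _ _) hD)
  have hD5 : D₅ ≤ D := le_trans (le_trans (le_max_left _ _) (le_max_right _ _)) (le_trans (le_max_left _ _) hD)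
  have hD1 : D₁ ≤ D := le_trans (le_trans (le_max_right _ _) (le_max_right _ _)) (le_trans (le_max_left _ _) hD)
  have hD8 : 8 ≤ D := le_trans (le_max_right _ _) hD
  obtain ⟨⟨⟨⟨hbD, h3D⟩, h4D⟩, h5D⟩, h141D⟩ := hall D χ hD0 hq hp
  -- `𝓛 > 0`, `α > 0`
  have hℓ : 0 < ell D := by
    rw [ell]; exact Real.log_pos (by exact_mod_cast (show 1 < D by omega))
  have hα : ‖(0 : ℂ)‖ < 5 * alpha D := by
    rw [norm_zero, alpha, bigP, Real.log_exp]
    positivity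
  -- (14.1), (14.2) for `κ₁* = κ₁ ∗ b`, `a₁* = g̃₃`
  have hκ : ∀ m, ‖kappaStar1 c' D (b D χ) m‖ ≤
      B * ((ArithmeticFunction.zeta ^ 5 : ArithmeticFunction ℕ) m : ℝ) := by
    intro m
    rw [← tau_eq_cast_zeta_pow]
    exact (norm_kappaStar1_le c' D hbD m).trans
      (mul_le_mul_of_nonneg_right hCbB (MeanSquareMajorant.tau_nonneg _ _))
  have ha : ∀ n, ‖aStar1 c' D n‖ ≤ B := fun n => (norm_gtilde3_le c' hℓ n).trans h1B
  have ha0 : ∀ n : ℕ, 2 * P4 D < n → aStar1 c' D n = 0 := fun n hn => gtilde3_eq_zero c' hn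
  have e141 := h141D hA 0 hα (kappaStar1 c' D (b D χ)) (aStar1 c' D) hκ ha ha0
  have e3 := h3D hA
  have e4 := h4D hA
  have e5 := h5D hA
  have hP1 : 1 ≤ frakP D := hD₁ D hD1
  have hε3 : C₃ * Real.exp (-c₃ * ell D ^ 10) ≤ ε / 4 * frakP D :=
    (hD₃ D hD3).trans (by nlinarith)
  have hε5 : C₅ * Real.exp (-c₅ * ell D ^ 10) ≤ ε / 4 * frakP D :=
    (hD₅ D hD5).trans (by nlinarith)
  rw [sum_Phi1pOf_eq_main141]
  set SI := ∑ x ∈ finsetOf (PsiOne χ), (I2pm c' χ x (alpha D) - I2pm c' χ x (-alpha D)) with hSI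
  set Sp := ∑ x ∈ finsetOf (PsiOne χ), I2pm c' χ x (alpha D) with hSp
  set Sm := ∑ x ∈ finsetOf (PsiOne χ), I2pm c' χ x (-alpha D) with hSm
  set Θ := Theta2 χ 0 (kappaStar1 c' D (b D χ)) (aStar1 c' D) with hΘ
  set M := main141 χ 0 (kappaStar1 c' D (b D χ)) (aStar1 c' D) with hM
  have hsplit : SI = Sp - Sm := by
    rw [hSI, hSp, hSm, ← Finset.sum_sub_distrib]
  have key : Phi1 c' χ - M = (Phi1 c' χ - SI) - Sm + (Sp - Θ) + (Θ - M) := by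
    rw [hsplit]; ring
  calc ‖Phi1 c' χ - M‖ = ‖(Phi1 c' χ - SI) - Sm + (Sp - Θ) + (Θ - M)‖ := by rw [key]
    _ ≤ ‖Phi1 c' χ - SI‖ + ‖Sm‖ + ‖Sp - Θ‖ + ‖Θ - M‖ := by
        refine (norm_add_le _ _).trans ?_
        gcongr
        refine (norm_add_le _ _).trans ?_
        gcongr
        exact norm_sub_le _ _
    _ ≤ C₃ * Real.exp (-c₃ * ell D ^ 10) + ε / 4 * frakP D +
          C₅ * Real.exp (-c₅ * ell D ^ 10) + ε / 4 * frakP D := by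
        gcongr
    _ ≤ ε / 4 * frakP D + ε / 4 * frakP D + ε / 4 * frakP D + ε / 4 * frakP D := by
        gcongr
    _ = ε * frakP D := by ring

/-- **(15.6) for the printed coefficients**, as the edge from the three preceding displays and
Proposition 14.1: `Eq15_3 → Eq15_4 → Eq15_5 bLit → Prop141 → Eq15_6 bLit` ((15.2) is a theorem,
`eq15_2_holds`). [cite: Zhang2022LandauSiegel, §15 (15.6) p. 81] -/
theorem eq15_6_lit_of (c' : ℝ) (h3 : Eq15_3 c') (h4 : Eq15_4 c') (h5 : Eq15_5 c' bLit)
    (h141 : Prop141) : Eq15_6 c' bLit := by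
  refine eq15_6_of c' bLit ?_ h3 h4 h5 h141
  obtain ⟨C, hC⟩ := eq15_2_holds
  exact ⟨C, hC.mono fun D _ χ _ _ h => h.1⟩

/-- The same edge for the χ-absorbed coefficients `bChi` (`|χ(n)b(n)| ≤ |b(n)|`).
[cite: Zhang2022LandauSiegel, §15 (15.6) p. 81] -/
theorem eq15_6_chi_of (c' : ℝ) (h3 : Eq15_3 c') (h4 : Eq15_4 c') (h5 : Eq15_5 c' bChi)
    (h141 : Prop141) : Eq15_6 c' bChi := by
  refine eq15_6_of c' bChi ?_ h3 h4 h5 h141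
  obtain ⟨C, hC⟩ := eq15_2_holds
  refine ⟨C, hC.mono fun D _ χ _ _ h n => ?_⟩
  calc ‖bChi D χ n‖ = ‖χ (n : ZMod D)‖ * ‖bcoef D n‖ := by rw [bChi, bchi, norm_mul]
    _ ≤ 1 * ‖bcoef D n‖ := by gcongr; exact DirichletCharacter.norm_le_one χ _
    _ ≤ C * MeanSquareMajorant.tau 2 n := by rw [one_mul]; exact h.1 n

end Edge156

/-! ## (15.1) kernel-checked: `B(s,ψ) = Σ_n b(n)χψ(n)n^{−s}`

The product of the two Dirichlet polynomials `H₁₄ + ι₂H₁₂` and `H₂ = ῑ₃H₁₃ + ῑ₄H₁₂` (12.2) is the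
Dirichlet polynomial with the convolved coefficients `b = Skeleton.bcoef` against the completely
multiplicative `χψ` — an exact identity for every `D` (Mathlib's `LSeries_convolution'` on finitely
supported sequences). -/

section Eq151

variable {D : ℕ} (χ : DirichletCharacter ℂ D) (x : Chr D)

/-- `χψ(0) = 0`. [folklore] -/
private theorem pc_zero' : pc χ x 0 = 0 := by
  haveI : Fact (1 < x.p) := ⟨x.prime.one_lt⟩
  rw [pc, Nat.cast_zero, Nat.cast_zero, MulChar.map_zero, zero_mul]

/-- `χψ` is completely multiplicative. [folklore] -/
private theorem pc_mul' (a b : ℕ) : pc χ x (a * b) = pc χ x a * pc χ x b := by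
  simp only [pc, Nat.cast_mul, map_mul]
  ring

/-- A finitely supported twisted Dirichlet series is summable everywhere and equals the finite sum
`Σ_{1 ≤ n < N}`. [folklore] -/
private theorem LSeries_twist_fin {w : ℕ → ℂ} {N : ℕ} (hw : ∀ n : ℕ, N ≤ n → w n = 0) (s : ℂ) :
    LSeriesSummable (fun n => w n * pc χ x n) s ∧
      LSeries (fun n => w n * pc χ x n) s =
        ∑ n ∈ Finset.Ico 1 N, w n * pc χ x n * (n : ℂ) ^ (-s) := by
  have hzero : ∀ n ∉ Finset.Ico 1 N, LSeries.term (fun n => w n * pc χ x n) s n = 0 := by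
    intro n hn
    rw [Finset.mem_Ico, not_and_or, not_le, not_lt] at hn
    rcases hn with hn | hn
    · have : n = 0 := by omega
      subst this
      exact LSeries.term_zero _ _
    · rw [LSeries.term_def₀ (by simp [pc_zero']), hw n hn]
      simp
  constructor
  · exact summable_of_ne_finset_zero hzero
  · rw [LSeries, tsum_eq_sum hzero]
    refine Finset.sum_congr rfl fun n _ => ?_
    rw [LSeries.term_def₀ (by simp [pc_zero'])]

/-- **The product of two finitely supported `χψ`-twisted Dirichlet polynomials** is the twisted
series of the convolved coefficients. [folklore] -/
private theorem tsum_conv_pc_eq {u v : ℕ → ℂ} {N : ℕ} (hu : ∀ n : ℕ, N ≤ n → u n = 0)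
    (hv : ∀ n : ℕ, N ≤ n → v n = 0) (s : ℂ) :
    (∑' n : ℕ, (∑ ab ∈ n.divisorsAntidiagonal, u ab.1 * v ab.2) * pc χ x n * (n : ℂ) ^ (-s)) =
      (∑ n ∈ Finset.Ico 1 N, u n * pc χ x n * (n : ℂ) ^ (-s)) *
        ∑ n ∈ Finset.Ico 1 N, v n * pc χ x n * (n : ℂ) ^ (-s) := by
  obtain ⟨hfs, hfL⟩ := LSeries_twist_fin χ x hu s
  obtain ⟨hgs, hgL⟩ := LSeries_twist_fin χ x hv s
  rw [← hfL, ← hgL, ← LSeries_convolution' hfs hgs, LSeries]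
  refine tsum_congr fun n => ?_
  have h0 : LSeries.convolution (fun n => u n * pc χ x n) (fun n => v n * pc χ x n) 0 = 0 := by
    simp
  rw [LSeries.term_def₀ h0]
  simp only [LSeries.convolution_def, Finset.sum_mul]
  refine Finset.sum_congr rfl fun ab hab => ?_
  have hprod : ab.1 * ab.2 = n := (Nat.mem_divisorsAntidiagonal.mp hab).1
  rw [← hprod, pc_mul']
  ring

/-- Extending a sum `Σ_{1 ≤ n < ⌈Q⌉}` of terms vanishing from `Q` on to `Σ_{1 ≤ n < N}`, `N ≥ ⌈Q⌉`.
[folklore] -/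
private theorem sum_Ico_extend {Q : ℝ} {N : ℕ} (hQ : ⌈Q⌉₊ ≤ N) (w : ℕ → ℂ)
    (hw : ∀ n : ℕ, Q ≤ n → w n = 0) (s : ℂ) :
    ∑ n ∈ Finset.Ico 1 ⌈Q⌉₊, w n * pc χ x n * (n : ℂ) ^ (-s) =
      ∑ n ∈ Finset.Ico 1 N, w n * pc χ x n * (n : ℂ) ^ (-s) := by
  apply Finset.sum_subset (Finset.Ico_subset_Ico_right hQ)
  intro n hn hn'
  rw [Finset.mem_Ico, not_and_or, not_le, not_lt] at hn'
  rcases hn' with h0 | hP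
  · exact absurd (Finset.mem_Ico.mp hn).1 (by omega)
  · rw [hw n (le_trans (Nat.le_ceil _) (by exact_mod_cast hP))]
    simp

/-- **`Z22:(15.1)` DISCHARGED**: `B(s,ψ) = Σ_n b(n)χψ(n)n^{−s}` with `b = Skeleton.bcoef`, for
every `D`, `ψ ∈ Ψ`, `s` (the finite Dirichlet polynomials of (12.1), (2.24)–(2.25) multiplied out).
[cite: Zhang2022LandauSiegel, §15 (15.1) p. 79] -/
theorem eq15_1_holds : Eq15_1 := by
  intro D _ χ x s
  set N := ⌈Skeleton.P1 D⌉₊ with hN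
  have hN2 : ⌈Skeleton.P2 D⌉₊ ≤ N := Nat.ceil_mono (P2_le_P1 D)
  have hN3 : ⌈Skeleton.P3 D⌉₊ ≤ N := Nat.ceil_mono (P3_le_P1 D)
  have hF : H14 χ x s + iota2 * H12 χ x s = ∑ n ∈ Finset.Ico 1 N,
      ((if (n : ℝ) < bigP D ^ (1 / 2 : ℝ) then vk1 D n else 0) + iota2 * vk2 D n) *
        pc χ x n * (n : ℂ) ^ (-s) := by
    rw [H14, Finset.sum_filter, H12, sum_Ico_extend χ x hN2 (vk2 D) (fun n hn => vk2_eq_zero hn) s,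
      Finset.mul_sum, ← Finset.sum_add_distrib]
    refine Finset.sum_congr rfl fun n _ => ?_
    split_ifs <;> ring
  have hG : H2 χ x s = ∑ n ∈ Finset.Ico 1 N,
      (conj iota3 * vk3 D n + conj iota4 * vk2 D n) * pc χ x n * (n : ℂ) ^ (-s) := by
    rw [H2, H13, H12, sum_Ico_extend χ x hN3 (vk3 D) (fun n hn => vk3_eq_zero hn) s,
      sum_Ico_extend χ x hN2 (vk2 D) (fun n hn => vk2_eq_zero hn) s, Finset.mul_sum,
      Finset.mul_sum, ← Finset.sum_add_distrib]
    refine Finset.sum_congr rfl fun n _ => ?_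
    ring
  have hu : ∀ n : ℕ, N ≤ n →
      (fun a : ℕ => (if (a : ℝ) < bigP D ^ (1 / 2 : ℝ) then vk1 D a else 0) + iota2 * vk2 D a) n
        = 0 := by
    intro n hn
    have h1 : Skeleton.P1 D ≤ n := Nat.ceil_le.mp hn
    have h2 : Skeleton.P2 D ≤ n := (P2_le_P1 D).trans h1
    simp only [vk1_eq_zero h1, vk2_eq_zero h2]
    split_ifs <;> simp
  have hv : ∀ n : ℕ, N ≤ n →
      (fun b : ℕ => conj iota3 * vk3 D b + conj iota4 * vk2 D b) n = 0 := by
    intro n hn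
    have h1 : Skeleton.P1 D ≤ n := Nat.ceil_le.mp hn
    simp only [vk3_eq_zero ((P3_le_P1 D).trans h1), vk2_eq_zero ((P2_le_P1 D).trans h1)]
    simp
  rw [Bpoly, hF, hG]
  exact (tsum_conv_pc_eq χ x hu hv s).symm

/-- **`Z22:(15.1)`, `ψ`-coefficient form, DISCHARGED**: `B(s,ψ) = Σ_n (χb)(n)ψ(n)n^{−s}`.
[cite: Zhang2022LandauSiegel, §15 (15.1) p. 79] -/
theorem eq15_1R_holds : Eq15_1R := eq15_1R_iff_eq15_1.mpr eq15_1_holds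

end Eq151

/-! ## `§15.u014` for the χ-absorbed coefficients, kernel-checked

With `b ↦ χ·b` the display "`L(s+β₁,ψ)L(s+β₂,ψ)B(s,ψ)/L(s,ψ) = Σ_m (κ₁∗b)(m)ψ(m)m^{−s}`, `σ > 1`" is
(15.1) (`eq15_1R_holds`) combined with the tree's twisted product rule
`MeanSquareMajorant.LSeries_twist_conv_kappa₁` and Mathlib's `LFunction = LSeries` on `σ > 1`. -/

section U014

/-- `b(n) = 0` for `n ≥ ⌈P₁⌉²` (the two factors of `b` are supported below `⌈P₁⌉`).
[cite: Zhang2022LandauSiegel, §15 (15.2) p. 79] -/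
private theorem bcoef_eq_zero_of_sq_le {D n : ℕ} (hn : ⌈Skeleton.P1 D⌉₊ ^ 2 ≤ n) :
    bcoef D n = 0 := by
  rw [bcoef]
  refine Finset.sum_eq_zero fun ab hab => ?_
  obtain ⟨hprod, _⟩ := Nat.mem_divisorsAntidiagonal.mp hab
  by_cases ha : ⌈Skeleton.P1 D⌉₊ ≤ ab.1
  · have h1 : Skeleton.P1 D ≤ ab.1 := Nat.ceil_le.mp ha
    rw [vk1_eq_zero h1, vk2_eq_zero ((P2_le_P1 D).trans h1)]
    split_ifs <;> simp
  · have hb : ⌈Skeleton.P1 D⌉₊ ≤ ab.2 := by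
      by_contra hb
      rw [not_le] at ha hb
      have : ab.1 * ab.2 < ⌈Skeleton.P1 D⌉₊ * ⌈Skeleton.P1 D⌉₊ := Nat.mul_lt_mul'' ha hb
      rw [hprod, ← pow_two] at this
      omega
    have h1 : Skeleton.P1 D ≤ ab.2 := Nat.ceil_le.mp hb
    rw [vk3_eq_zero ((P3_le_P1 D).trans h1), vk2_eq_zero ((P2_le_P1 D).trans h1)]
    simp

open scoped LSeries.notation in
/-- **`Z22:§15.u014` DISCHARGED at `b = bChi`** (the χ-absorbed reading of the module note): for
`σ > 1`, `L(s+β₁,ψ)L(s+β₂,ψ)B(s,ψ)/L(s,ψ) = Σ_m (κ₁∗(χb))(m)ψ(m)m^{−s}`.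
[cite: Zhang2022LandauSiegel, §15 p. 81] -/
theorem step15_u014_chi_holds (c' : ℝ) : Step15_u014 c' bChi := by
  intro D _ χ x s hs
  haveI : Fact (1 < x.p) := ⟨x.prime.one_lt⟩
  have hψ0 : x.ψ ((0 : ℕ) : ZMod x.p) = 0 := by
    rw [Nat.cast_zero, MulChar.map_zero]
  -- summability of the finitely supported `ψ · (χb)`
  have hsupp : ∀ n : ℕ, ⌈Skeleton.P1 D⌉₊ ^ 2 ≤ n → bChi D χ n = 0 := fun n hn => by
    rw [show bChi D χ n = bchi χ n from rfl, bchi, bcoef_eq_zero_of_sq_le hn, mul_zero]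
  have h0 : (↗x.ψ * bChi D χ) 0 = 0 := by rw [Pi.mul_apply, hψ0, zero_mul]
  have hb : LSeriesSummable (↗x.ψ * bChi D χ) s := by
    refine summable_of_ne_finset_zero (s := Finset.range (⌈Skeleton.P1 D⌉₊ ^ 2)) fun n hn => ?_
    rw [Finset.mem_range, not_lt] at hn
    rw [LSeries.term_def₀ h0, Pi.mul_apply, hsupp n hn]
    simp
  -- `B(s,ψ)` is the `L`-series of `ψ · (χb)` ((15.1), `ψ`-coefficient form)
  have hB : Bpoly χ x s = L (↗x.ψ * bChi D χ) s := by
    rw [eq15_1R_holds D χ x s, LSeries]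
    refine tsum_congr fun n => ?_
    rw [LSeries.term_def₀ h0, Pi.mul_apply, show bChi D χ n = bchi χ n from rfl]
    ring
  have key := MeanSquareMajorant.LSeries_twist_conv_kappa₁ (b1 c' D) (b2 c' D) x.ψ hs hb
  -- the right side of u014 is the `L`-series of `ψ · (κ₁ ∗ χb)`
  have hc0 : (↗x.ψ * MeanSquareMajorant.conv (MeanSquareMajorant.kappa₁ (b1 c' D) (b2 c' D))
      (bChi D χ)) 0 = 0 := by rw [Pi.mul_apply, hψ0, zero_mul]
  have hR : (∑' m : ℕ, kappaStar1 c' D (bChi D χ) m * x.ψ (m : ZMod x.p) / (m : ℂ) ^ s) =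
      L (↗x.ψ * MeanSquareMajorant.conv (MeanSquareMajorant.kappa₁ (b1 c' D) (b2 c' D))
        (bChi D χ)) s := by
    rw [LSeries]
    refine tsum_congr fun m => ?_
    rw [LSeries.term_def₀ hc0, Pi.mul_apply, kappaStar1, kappa1, div_eq_mul_inv, cpow_neg]
    ring
  have hβ₁ : beta1 c' D = (b1 c' D : ℂ) * I := by simp only [beta1, b1]; push_cast; ring
  have hβ₂ : beta2 c' D = (b2 c' D : ℂ) * I := by simp only [beta2, b2]; push_cast; ring
  have hre1 : 1 < (s + beta1 c' D).re := by rw [hβ₁]; simpa using hs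
  have hre2 : 1 < (s + beta2 c' D).re := by rw [hβ₂]; simpa using hs
  rw [hR, key, ← hB, DirichletCharacter.LFunction_eq_LSeries _ hs,
    DirichletCharacter.LFunction_eq_LSeries _ hre1, DirichletCharacter.LFunction_eq_LSeries _ hre2,
    hβ₁, hβ₂]
  ring

end U014

/-! ## `§15.u010`, kernel-checked (the tree's Gaussian line integral) -/

section U010

/-- **`Z22:§15.u010` DISCHARGED**: `(1/2πi)∫_{(−1/2)} ω(s)ds/(n^s(Dm)^{1−s}) =
(Dm)⁻¹(Dm/n)^{s₀}exp{−𝓛₂²log²(Dm/n)}` for `D ≥ 2`, `n, m ≥ 1` — the tree's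
`SmoothWeight.integral_omega_div_cpow_mul_cpow` (sz-d54) at `c = −1/2`, `M = Dm`, `𝓛₂ = (log D)⁴⁰⁰ > 0`.
[cite: Zhang2022LandauSiegel, §15 p. 81] -/
theorem step15_u010_holds : Step15_u010 := by
  intro D n m hD hn hm
  have hℓ : 0 < ell D := by
    rw [ell]; exact Real.log_pos (by exact_mod_cast (show 1 < D by omega))
  have hL2 : 0 < ell2 D := by rw [ell2]; positivity
  have hn' : (0 : ℝ) < n := by exact_mod_cast hn
  have hDm : 0 < D * m := Nat.mul_pos (by omega) hm
  have hM' : (0 : ℝ) < ((D * m : ℕ) : ℝ) := by exact_mod_cast hDm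
  have key := SmoothWeight.integral_omega_div_cpow_mul_cpow hL2 (t0 D) (-1 / 2) hn' hM'
  have hc : (((-1 / 2 : ℝ)) : ℂ) = -1 / 2 := by push_cast; ring
  have hfun : (fun t : ℝ => omegaW D (-1 / 2 + t * I) /
      ((n : ℂ) ^ (-1 / 2 + t * I : ℂ) * ((D * m : ℕ) : ℂ) ^ (1 - (-1 / 2 + t * I : ℂ)))) =
      fun t : ℝ => SmoothWeight.omega (ell2 D) (t0 D) (((-1 / 2 : ℝ) : ℂ) + t * I) *
        (n : ℂ) ^ (-((((-1 / 2 : ℝ) : ℂ)) + t * I)) *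
        ((((D * m : ℕ) : ℝ)) : ℂ) ^ (((((-1 / 2 : ℝ) : ℂ)) + t * I) - 1) := by
    funext t
    rw [hc, omegaW, div_eq_mul_inv, mul_inv, ← Complex.cpow_neg, ← Complex.cpow_neg, neg_sub,
      Complex.ofReal_natCast, mul_assoc]
  rw [hfun]
  simp only [Complex.ofReal_natCast] at key ⊢
  rw [key, s0, Complex.ofReal_exp]
  push_cast
  ring_nf

end U010

/-! ## `§15.u018`, kernel-checked: the regrouping `(κ₁∗b)(dl) = Σ_{d=d₁d₂}Σ_{l=l₁l₂,(l₁,d₂)=1} b(d₂l₂)κ₁(d₁l₁)`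

"Similar to (7.17)": the bijection `(d₁,d₂,l₁,l₂) ↦ (m₁,m₂) = (d₁l₁, d₂l₂)` between the indexing set
and the factorisations `m₁m₂ = dl`, with inverse `d₁ = (m₁, d)`; pure arithmetic, valid for every
pair of sequences. -/

section U018

/-- The inverse map of the regrouping: from `uv = dl` (`d > 0`) with `g = (u,d)`:
`g ∣ u`, `g·(d/g) = d`, `(u/g, d/g) = 1`, `d/g ∣ v` and `(u/g)(v/(d/g)) = l`. [folklore] -/
private theorem regroup_aux {d l u v : ℕ} (hd : 0 < d) (huv : u * v = d * l) :
    Nat.gcd u d ∣ u ∧ Nat.gcd u d * (d / Nat.gcd u d) = d ∧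
      Nat.Coprime (u / Nat.gcd u d) (d / Nat.gcd u d) ∧ d / Nat.gcd u d ∣ v ∧
      (u / Nat.gcd u d) * (v / (d / Nat.gcd u d)) = l := by
  set g := Nat.gcd u d with hg
  have hg0 : 0 < g := Nat.gcd_pos_of_pos_right u hd
  have hgd : g ∣ d := Nat.gcd_dvd_right u d
  have hgu : g ∣ u := Nat.gcd_dvd_left u d
  have hd₂ : g * (d / g) = d := Nat.mul_div_cancel' hgd
  have hl₁ : g * (u / g) = u := Nat.mul_div_cancel' hgu
  have hcop : Nat.Coprime (u / g) (d / g) := Nat.coprime_div_gcd_div_gcd hg0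
  have hd₂0 : 0 < d / g := Nat.div_pos (Nat.le_of_dvd hd hgd) hg0
  have h1 : (u / g) * v = (d / g) * l := by
    have : g * ((u / g) * v) = g * ((d / g) * l) := by
      calc g * ((u / g) * v) = (g * (u / g)) * v := by ring
        _ = u * v := by rw [hl₁]
        _ = d * l := huv
        _ = (g * (d / g)) * l := by rw [hd₂]
        _ = g * ((d / g) * l) := by ring
    exact Nat.eq_of_mul_eq_mul_left hg0 this
  have hd₂v : d / g ∣ v := by
    have : d / g ∣ (u / g) * v := ⟨l, h1⟩
    exact hcop.symm.dvd_of_dvd_mul_left this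
  have hl₂ : (d / g) * (v / (d / g)) = v := Nat.mul_div_cancel' hd₂v
  have h2 : (u / g) * (v / (d / g)) = l := by
    have : (d / g) * ((u / g) * (v / (d / g))) = (d / g) * l := by
      calc (d / g) * ((u / g) * (v / (d / g))) = (u / g) * ((d / g) * (v / (d / g))) := by ring
        _ = (u / g) * v := by rw [hl₂]
        _ = (d / g) * l := h1
    exact Nat.eq_of_mul_eq_mul_left hd₂0 this
  exact ⟨hgu, hd₂, hcop, hd₂v, h2⟩

/-- **The regrouping of a Dirichlet convolution at a product `dl`** (the manuscript's (7.17)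
pattern): `Σ_{m₁m₂=dl} κ(m₁)β(m₂) = Σ_{d=d₁d₂} Σ_{l=l₁l₂,(l₁,d₂)=1} β(d₂l₂)κ(d₁l₁)`, `d, l ≥ 1`.
[cite: Zhang2022LandauSiegel, §7 (7.17), §15 p. 82] -/
theorem sum_divisorsAntidiagonal_mul_regroup (κ β : ℕ → ℂ) {d l : ℕ} (hd : 0 < d) (hl : 0 < l) :
    ∑ x ∈ (d * l).divisorsAntidiagonal, κ x.1 * β x.2 =
      ∑ dd ∈ d.divisorsAntidiagonal,
        ∑ ll ∈ (l.divisorsAntidiagonal).filter (fun ll => Nat.Coprime ll.1 dd.2),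
          β (dd.2 * ll.2) * κ (dd.1 * ll.1) := by
  rw [Finset.sum_sigma']
  symm
  refine Finset.sum_nbij' (fun a => (a.1.1 * a.2.1, a.1.2 * a.2.2))
    (fun x => ⟨(Nat.gcd x.1 d, d / Nat.gcd x.1 d), (x.1 / Nat.gcd x.1 d, x.2 / (d / Nat.gcd x.1 d))⟩)
    ?_ ?_ ?_ ?_ ?_
  · rintro ⟨⟨d₁, d₂⟩, ⟨l₁, l₂⟩⟩ ha
    simp only [Finset.mem_sigma, Nat.mem_divisorsAntidiagonal,
      Finset.mem_filter] at ha
    obtain ⟨⟨hdd, hd0⟩, ⟨hll, hl0⟩, -⟩ := ha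
    simp only [Nat.mem_divisorsAntidiagonal]
    refine ⟨?_, Nat.mul_ne_zero hd0 hl0⟩
    rw [← hdd, ← hll]
    ring
  · rintro ⟨u, v⟩ hx
    simp only [Nat.mem_divisorsAntidiagonal] at hx
    obtain ⟨huv, -⟩ := hx
    obtain ⟨-, hd₂, hcop, -, h2⟩ := regroup_aux hd huv
    simp only [Finset.mem_sigma, Nat.mem_divisorsAntidiagonal, Finset.mem_filter]
    exact ⟨⟨hd₂, hd.ne'⟩, ⟨h2, hl.ne'⟩, hcop⟩
  · rintro ⟨⟨d₁, d₂⟩, ⟨l₁, l₂⟩⟩ ha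
    simp only [Finset.mem_sigma, Nat.mem_divisorsAntidiagonal,
      Finset.mem_filter] at ha
    obtain ⟨⟨hdd, hd0⟩, ⟨hll, hl0⟩, hcop⟩ := ha
    have hd₁ : 0 < d₁ := Nat.pos_of_ne_zero fun h => hd0 (by rw [← hdd, h, zero_mul])
    have hd₂ : 0 < d₂ := Nat.pos_of_ne_zero fun h => hd0 (by rw [← hdd, h, mul_zero])
    have hg : Nat.gcd (d₁ * l₁) d = d₁ := by
      rw [← hdd, Nat.gcd_mul_left, hcop, mul_one]
    have e1 : d / d₁ = d₂ := by rw [← hdd, Nat.mul_div_cancel_left _ hd₁]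
    have e2 : d₁ * l₁ / d₁ = l₁ := Nat.mul_div_cancel_left _ hd₁
    have e3 : d₂ * l₂ / d₂ = l₂ := Nat.mul_div_cancel_left _ hd₂
    simp only [hg, e1, e2, e3]
  · rintro ⟨u, v⟩ hx
    simp only [Nat.mem_divisorsAntidiagonal] at hx
    obtain ⟨huv, -⟩ := hx
    obtain ⟨hgu, -, -, hd₂v, -⟩ := regroup_aux hd huv
    simp only [Nat.mul_div_cancel' hgu, Nat.mul_div_cancel' hd₂v]
  · rintro ⟨⟨d₁, d₂⟩, ⟨l₁, l₂⟩⟩ _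
    simp only
    ring

/-- **`Z22:§15.u018` DISCHARGED** (for every coefficient family `b`, in particular the printed
`bLit` and the χ-absorbed `bChi`): `(κ₁∗b)(dl) = Σ_{d=d₁d₂}Σ_{l=l₁l₂,(l₁,d₂)=1} b(d₂l₂)κ₁(d₁l₁)`.
[cite: Zhang2022LandauSiegel, §15 p. 82] -/
theorem step15_u018_holds (c' : ℝ) (b : CoefFam) : Step15_u018 c' b := by
  intro D _ χ d l hd hl
  exact sum_divisorsAntidiagonal_mul_regroup (fun n => kappa1 c' D n) (b D χ) hd hl

end U018

/-! ## `§15.u011`, kernel-checked: orthogonality of the primitive characters mod `p ∼ P`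

The tree's `PrimitiveCharOrthogonality.lean` (sz-d54) proves, to a prime modulus, that the primitive
characters are the non-principal ones and evaluates `Σ_{ψ ≠ 1} ψ(m)ψ⁻¹(n)` exactly; here that is
bridged to the slice's `sumPrim` and to the printed window hypotheses `n < PT⁻⁵`, `Dm < 2n`
(which put `n` and `Dm` below `p`, so that `n ≡ Dm (mod p)` is `n = Dm`). -/

section U011

/-- `Σ*_{ψ (mod p)} F(ψ)` over the primitive characters to a PRIME modulus is the sum over `ψ ≠ 1`
(`PrimChar.isPrimitive_iff_ne_one`). [cite: Zhang2022LandauSiegel, §2 p. 4] -/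
theorem sumPrim_eq_sum_erase_one {p : ℕ} [Fact p.Prime] (F : DirichletCharacter ℂ p → ℂ) :
    sumPrim (fun ψ _ => F ψ) = ∑ ψ ∈ (Finset.univ : Finset (DirichletCharacter ℂ p)).erase 1, F ψ := by
  rw [sumPrim, finsum_eq_sum_of_fintype,
    ← Finset.add_sum_erase _ _ (Finset.mem_univ (1 : DirichletCharacter ℂ p)),
    dif_neg (fun h => ((PrimChar.isPrimitive_iff_ne_one (1 : DirichletCharacter ℂ p)).mp h) rfl),
    zero_add]
  exact Finset.sum_congr rfl fun ψ hψ =>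
    dif_pos ((PrimChar.isPrimitive_iff_ne_one ψ).mpr (Finset.mem_erase.mp hψ).1)

/-- Window primes exceed `P`: `p ∼ P ⇒ P < p`. [cite: Zhang2022LandauSiegel, §2 p. 4] -/
private theorem bigP_lt_of_mem_window {D p : ℕ} (hp : p ∈ primeWindow D) : bigP D < p := by
  have h := (Finset.mem_Ioo.mp (Finset.mem_filter.mp hp).1).1
  exact (Nat.floor_lt (Real.exp_pos _).le).mp h

/-- **`Z22:§15.u011` DISCHARGED** (with `C = 1`, for `D ≥ 3`): for `p ∼ P`, `n < PT⁻⁵` and `Dm < 2n`,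
`|Σ*_{ψ (mod p)} ψ(n)ψ̄(Dm)| ≤ p` if `n = Dm` and `≤ 1` if `n ≠ Dm` — both `n, Dm < P < p`
(`T⁵ ≥ 2`), so the congruence `n ≡ Dm (mod p)` forces `n = Dm`, and the tree's exact evaluation
`PrimChar.sum_ne_one_apply_mul_inv_apply` gives `p − 2`, resp. `−[p ∤ nDm]`.
[cite: Zhang2022LandauSiegel, §15 p. 81] -/
theorem step15_u011_holds : Step15_u011 := by
  refine ⟨1, 3, fun D _ χ hD _ _ => ?_⟩
  intro p hp n m hn hDm
  haveI : Fact p.Prime := ⟨(Finset.mem_filter.mp hp).2⟩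
  have hP : bigP D < p := bigP_lt_of_mem_window hp
  have hD3 : (3 : ℝ) ≤ D := by exact_mod_cast hD
  have hℓ : 1 ≤ ell D := by
    rw [ell, ← Real.log_exp 1]
    exact Real.log_le_log (Real.exp_pos 1)
      (le_trans (le_of_lt (lt_trans Real.exp_one_lt_d9 (by norm_num))) hD3)
  have hT : Real.exp 1 ≤ bigT D := by
    rw [bigT]
    exact Real.exp_le_exp.mpr (Real.one_le_rpow hℓ (by norm_num))
  have hT2 : (2 : ℝ) ≤ bigT D ^ 5 := by
    have h1 : (2 : ℝ) ≤ Real.exp 1 := by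
      have := Real.add_one_le_exp (1 : ℝ); linarith
    calc (2 : ℝ) ≤ Real.exp 1 := h1
      _ ≤ bigT D := hT
      _ ≤ bigT D ^ 5 := le_self_pow₀ (le_trans (by linarith) hT) (by norm_num)
  have hT0 : 0 < bigT D ^ 5 := lt_of_lt_of_le (by norm_num) hT2
  have hPpos : 0 < bigP D := Real.exp_pos _
  have hn_lt : n < p := by
    have h1 : bigP D / bigT D ^ 5 ≤ bigP D := by
      rw [div_le_iff₀ hT0]
      nlinarith
    exact_mod_cast (lt_trans (lt_of_lt_of_le hn h1) hP : (n : ℝ) < p)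
  have hDm_lt : D * m < p := by
    have h1 : 2 * (bigP D / bigT D ^ 5) ≤ bigP D := by
      rw [mul_div_assoc', div_le_iff₀ hT0]
      nlinarith
    have h2 : ((D * m : ℕ) : ℝ) < p :=
      lt_trans (lt_of_lt_of_le (lt_of_lt_of_le hDm (by linarith)) h1) hP
    exact_mod_cast h2
  rw [sumPrim_eq_sum_erase_one (fun ψ => ψ (n : ZMod p) * conj (ψ ((D * m : ℕ) : ZMod p)))]
  simp_rw [← PrimChar.inv_apply_eq_conj]
  by_cases h : n = D * m
  · rw [if_pos h]
    have hp2 : (0 : ℝ) ≤ p := Nat.cast_nonneg p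
    calc ‖∑ ψ ∈ (Finset.univ : Finset (DirichletCharacter ℂ p)).erase 1,
            ψ (n : ZMod p) * ψ⁻¹ ((D * m : ℕ) : ZMod p)‖ ≤ (p : ℝ) - 1 :=
          PrimChar.norm_sum_ne_one_le _ _
      _ ≤ 1 * p := by linarith
  · rw [if_neg h]
    exact PrimChar.norm_sum_ne_one_le_one_of_ne fun hh =>
      h ((PrimChar.natCast_eq_natCast_iff_of_lt hn_lt hDm_lt).mp hh)

end U011

end Literature.NumberTheory.LFunctions.Zhang2022.Typed.Section15A
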